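import Literature.Probability.Process.BrownianCellMoments
import Literature.Probability.Process.PartitionPathwise
import Literature.Analysis.FunctionSpaces.ItoProcessesProofs
import HarnessLib

/-!
# [LSW] Lemma 8.9 by conditional increments: the abstract cell scheme and its martingale

G. F. Lawler, O. Schramm, W. Werner, *Conformal restriction: the chordal case*, J. Amer. Math.
Soc. **16** (2003) 917–955 (**[LSW]**), §8.4, Lemma 8.9: "`M_t` is a local martingale", proved
there by Itô's formula for the random conformal maps `h_t` along the SLE(8/3, ρ) driving pair
`dW = √κ dB + ρ dt/Z`, `dO = −2 dt/Z`, `Z = W − O`.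

This file isolates the PROBABILISTIC part of an Itô-free proof. A `CellScheme` is a hypothesis
bundle on the canonical space `(ℝ≥0 → ℝ, preWienerMeasure)` with the canonical Brownian motion
`B` and its raw filtration `𝓕`: a `[0, 1]`-valued adapted process `Y` (the candidate martingale,
`M_t = G(A_t − W_t, O_t − W_t)` in the application), the clock `I = ∫ J` (`J = 1/Z` off the zero set
of `Z = W + 2I ≥ 0`, a.s. and up to `τ`; `I ≤ K` up to `τ`), the driver `W = √κ B + ρ I` (a.s.),
complex adapted "jet" processes `ℓ₁, m₁, ℓ₂, λ` bounded by `K` up to the stopping time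
`τ ≤ T_max` and tied, almost surely and strictly before `τ`, by the
DRIFT IDENTITY `ρ ℓ₁ − 2 m₁ + Z (λ + (κ/2)(ℓ₂ + ℓ₁²)) = 0` ([LSW] Lemma 8.9's vanishing drift, in
the multiplied form valid up to the diagonal `Z = 0`), and the deterministic ONE-STEP EXPANSION
(pathwise, for every sample): for a base time `t₁ ≤ τ` and a short step to `t₂` with small
oscillation of `W` and small increment of `I`,
`|Y_{t₂} − Y_{t₁} − Y_{t₁}(ℓ₁ x + m₁ a + ½(ℓ₂ + ℓ₁²) x² + h λ)| ≤ K · poly(|x|, |a|, h, S + 4√h)`,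
`x = W_{t₂} − W_{t₁}`, `a = −2(I_{t₂} − I_{t₁})`, `h = t₂ − t₁`.

* `SLEKappaRho.CellScheme.martingale_stoppedProcess` — **under a cell scheme, `Y^τ` is an
  `𝓕`-martingale.** Proof by conditional increments over uniform partitions of `[s, t]`: on each
  cell the stopped increment of `Y`, tested against an `𝓕_s`-event, splits into the martingale
  part `ξ¹ ΔB + ξ² (ΔB² − h)` with bounded `𝓕_{tᵢ}`-measurable coefficients — of integral ZERO
  (`integral_mul_brownian_sub_eq_zero`, `integral_mul_sqIncr_eq_zero`) — and a remainder, which is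
  `O(1)` on the cells of large Brownian oscillation (total expectation `o(1)` by the `O(h²)` tail,
  `BrownianCellMoments`), and otherwise controlled by the one-step expansion: the drift
  `φ ΔI + h H = H (h − Z ΔI)` (`φ = −Z H` by the drift identity) is bounded through
  `|h − Z(tᵢ) ΔI| ≤ osc(Z) ΔI + Leb(cell ∩ {Z = 0})` (`abs_sub_mul_integral_le`), the cross and
  error terms by `ΔI · (small)` and Brownian moments; the pathwise sums tend to `0` almost surely
  (uniform continuity of the paths, `Leb{Z = 0} = 0`, `Σ ΔI ≤ K`) under a uniform bound, and
  dominated convergence finishes.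
* `SLEKappaRho.CellScheme.adapted_stoppedProcess`, `…ae_continuous_stoppedProcess` — the stopped
  process is adapted (dyadic approximation of `τ` and right-continuity of `Y` at `τ`) and almost
  every one of its paths is continuous (one-step bound).

No named facts; the scheme is discharged for [LSW]'s `M` in the sequel.

## References

* [LSW] §8.4, Lemma 8.9 and its proof. [LawlerSchrammWerner2003Restriction]
* D. Revuz, M. Yor, *Continuous Martingales and Brownian Motion* (1999), Ch. II Prop. (1.2),
  Thm (1.7); Ch. IV (3.3). [RevuzYor1999]
-/

noncomputable section

open MeasureTheory ProbabilityTheory Filter Set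
open scoped NNReal ENNReal Topology

namespace Literature.Probability.RandomPlanarGeometry

namespace SLEKappaRho

open Literature.Probability.Process Literature.Analysis.FunctionSpaces
open Literature.Probability.Process.IsBrownianVec (grid grid_zero grid_succ grid_self le_grid grid_le)

/-! ### The cell polynomial and the constants -/

/-- The error polynomial of the one step: `u e + u² + X³ + A² + A X + u A + u X`
(`X = |x|`, `A = |a|`, `u = h`, `e = S + 4√h`). [folklore] -/
def cellPoly (X A u e : ℝ) : ℝ := u * e + u ^ 2 + X ^ 3 + A ^ 2 + A * X + u * A + u * X

/-- `cellPoly` is nonnegative on nonnegative arguments. [folklore] -/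
theorem cellPoly_nonneg {X A u e : ℝ} (hX : 0 ≤ X) (hA : 0 ≤ A) (hu : 0 ≤ u) (he : 0 ≤ e) : 0 ≤ cellPoly X A u e := by
  unfold cellPoly; positivity

/-- `cellPoly` is monotone in each (nonnegative) argument. [folklore] -/
theorem cellPoly_mono {X A u e X' A' u' e' : ℝ} (hX : 0 ≤ X) (hA : 0 ≤ A) (hu : 0 ≤ u) (he : 0 ≤ e)
    (hXX : X ≤ X') (hAA : A ≤ A') (huu : u ≤ u') (hee : e ≤ e') : cellPoly X A u e ≤ cellPoly X' A' u' e' := by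
  unfold cellPoly
  have hX' : 0 ≤ X' := hX.trans hXX
  have hA' : 0 ≤ A' := hA.trans hAA
  have hu' : 0 ≤ u' := hu.trans huu
  gcongr

/-- The martingale part of the model: `√κ ℓ₁ ΔB + (κ/2)(ℓ₂ + ℓ₁²)(ΔB² − h)`. [folklore] -/
def martPart (κ : ℝ) (ℓ₁ ℓ₂ : ℂ) (ΔB h : ℝ) : ℂ :=
  (Real.sqrt κ : ℂ) * ℓ₁ * ΔB + (κ / 2 : ℝ) * (ℓ₂ + ℓ₁ ^ 2) * ((ΔB ^ 2 - h : ℝ) : ℂ)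

/-- The bound of `|martPart|`: `√κ K |ΔB| + (κ/2)(K + K²)(ΔB² + h)`. [folklore] -/
def martBound (κ K dB h : ℝ) : ℝ := Real.sqrt κ * K * dB + κ / 2 * (K + K ^ 2) * (dB ^ 2 + h)

/-- `|martPart| ≤ martBound`. [folklore] -/
theorem norm_martPart_le {κ K : ℝ} (hκ : 0 ≤ κ) {ℓ₁ ℓ₂ : ℂ} (h1 : ‖ℓ₁‖ ≤ K) (h2 : ‖ℓ₂‖ ≤ K) (ΔB : ℝ) {h : ℝ} (hh : 0 ≤ h) :
    ‖martPart κ ℓ₁ ℓ₂ ΔB h‖ ≤ martBound κ K |ΔB| h := by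
  have hK : 0 ≤ K := (norm_nonneg _).trans h1
  have hsq : ‖ℓ₂ + ℓ₁ ^ 2‖ ≤ K + K ^ 2 := (norm_add_le _ _).trans (add_le_add h2 (by rw [norm_pow]; gcongr))
  unfold martPart martBound
  refine (norm_add_le _ _).trans (add_le_add ?_ ?_)
  · rw [norm_mul, norm_mul, Complex.norm_real, Complex.norm_real, Real.norm_eq_abs, Real.norm_eq_abs,
      abs_of_nonneg (Real.sqrt_nonneg κ)]
    gcongr
  · rw [norm_mul, norm_mul, Complex.norm_real, Complex.norm_real, Real.norm_eq_abs, Real.norm_eq_abs,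
      abs_of_nonneg (by positivity : 0 ≤ κ / 2)]
    have : |ΔB ^ 2 - h| ≤ |ΔB| ^ 2 + h := by
      rw [← sq_abs]; exact (abs_sub _ _).trans (by rw [abs_of_nonneg (sq_nonneg _), abs_of_nonneg hh])
    gcongr

/-! ### The algebra of one cell -/

/-- **The model splits into martingale part, drift and cross terms**: with `x = √κ ΔB + ρ ΔI`,
`a = −2 ΔI`,
`ℓ₁ x + m₁ a + ½(ℓ₂ + ℓ₁²) x² + h λ = martPart + [(ρℓ₁ − 2m₁) ΔI + h (λ + (κ/2)(ℓ₂ + ℓ₁²))] + ½(ℓ₂ + ℓ₁²)(2√κ ρ ΔB ΔI + ρ² ΔI²)`.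
[cite: LawlerSchrammWerner2003Restriction, proof of Lemma 8.9 (Itô's formula for dM_t)] -/
theorem model_split {κ : ℝ} (hκ : 0 ≤ κ) (ρ : ℝ) (ℓ₁ m₁ ℓ₂ lam : ℂ) (ΔB ΔI h : ℝ) :
    ℓ₁ * ((Real.sqrt κ * ΔB + ρ * ΔI : ℝ) : ℂ) + m₁ * ((-2 * ΔI : ℝ) : ℂ) +
        2⁻¹ * (ℓ₂ + ℓ₁ ^ 2) * ((Real.sqrt κ * ΔB + ρ * ΔI : ℝ) : ℂ) ^ 2 + (h : ℂ) * lam =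
      martPart κ ℓ₁ ℓ₂ ΔB h +
        (((ρ : ℂ) * ℓ₁ - 2 * m₁) * ΔI + (h : ℂ) * (lam + (κ / 2 : ℝ) * (ℓ₂ + ℓ₁ ^ 2))) +
        2⁻¹ * (ℓ₂ + ℓ₁ ^ 2) * ((2 * Real.sqrt κ * ρ * ΔB * ΔI + ρ ^ 2 * ΔI ^ 2 : ℝ) : ℂ) := by
  have hs : ((Real.sqrt κ : ℝ) : ℂ) ^ 2 = (κ : ℂ) := by rw [← Complex.ofReal_pow, Real.sq_sqrt hκ]
  unfold martPart
  push_cast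
  linear_combination (2⁻¹ * (ℓ₂ + ℓ₁ ^ 2) * (ΔB : ℂ) ^ 2) * hs

/-- **The drift of one cell is `H (h − Z ΔI)`** under the drift identity `ρℓ₁ − 2m₁ + Z H = 0`,
`H = λ + (κ/2)(ℓ₂ + ℓ₁²)`. [cite: LawlerSchrammWerner2003Restriction, Lemma 8.9] -/
theorem drift_eq {κ ρ Z : ℝ} {ℓ₁ m₁ ℓ₂ lam : ℂ}
    (hid : (ρ : ℂ) * ℓ₁ - 2 * m₁ + (Z : ℂ) * (lam + (κ / 2 : ℝ) * (ℓ₂ + ℓ₁ ^ 2)) = 0) (ΔI h : ℝ) :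
    ((ρ : ℂ) * ℓ₁ - 2 * m₁) * ΔI + (h : ℂ) * (lam + (κ / 2 : ℝ) * (ℓ₂ + ℓ₁ ^ 2)) =
      (lam + (κ / 2 : ℝ) * (ℓ₂ + ℓ₁ ^ 2)) * ((h - Z * ΔI : ℝ) : ℂ) := by
  have hφ : (ρ : ℂ) * ℓ₁ - 2 * m₁ = -(Z : ℂ) * (lam + (κ / 2 : ℝ) * (ℓ₂ + ℓ₁ ^ 2)) := by
    linear_combination hid
  rw [hφ]; push_cast; ring

/-- **Interior cell**: from the one-step inequality and the drift identity,
`|(Y₁ − Y₀) − Y₀ · martPart| ≤ R + (K + (κ/2)(K + K²)) |h − Z ΔI| + ½(K + K²)(2√κ|ρ| |ΔB| ΔI + ρ² ΔI²)`.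
[cite: LawlerSchrammWerner2003Restriction, proof of Lemma 8.9] -/
theorem norm_sub_martPart_le_interior {κ ρ K Z Y₀ Y₁ ΔB ΔI h R : ℝ} (hκ : 0 ≤ κ) (hY₀ : |Y₀| ≤ 1) (hΔI : 0 ≤ ΔI)
    {ℓ₁ m₁ ℓ₂ lam : ℂ} (h1 : ‖ℓ₁‖ ≤ K) (h2 : ‖ℓ₂‖ ≤ K) (hl : ‖lam‖ ≤ K)
    (hid : (ρ : ℂ) * ℓ₁ - 2 * m₁ + (Z : ℂ) * (lam + (κ / 2 : ℝ) * (ℓ₂ + ℓ₁ ^ 2)) = 0)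
    (hstep : ‖((Y₁ : ℝ) : ℂ) - Y₀ - Y₀ * (ℓ₁ * ((Real.sqrt κ * ΔB + ρ * ΔI : ℝ) : ℂ) + m₁ * ((-2 * ΔI : ℝ) : ℂ) +
        2⁻¹ * (ℓ₂ + ℓ₁ ^ 2) * ((Real.sqrt κ * ΔB + ρ * ΔI : ℝ) : ℂ) ^ 2 + (h : ℂ) * lam)‖ ≤ R) :
    ‖(((Y₁ - Y₀ : ℝ)) : ℂ) - Y₀ * martPart κ ℓ₁ ℓ₂ ΔB h‖ ≤
      R + (K + κ / 2 * (K + K ^ 2)) * |h - Z * ΔI| + 2⁻¹ * (K + K ^ 2) * (2 * Real.sqrt κ * |ρ| * |ΔB| * ΔI + ρ ^ 2 * ΔI ^ 2) := by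
  have hK : 0 ≤ K := (norm_nonneg _).trans h1
  set model := ℓ₁ * ((Real.sqrt κ * ΔB + ρ * ΔI : ℝ) : ℂ) + m₁ * ((-2 * ΔI : ℝ) : ℂ) +
        2⁻¹ * (ℓ₂ + ℓ₁ ^ 2) * ((Real.sqrt κ * ΔB + ρ * ΔI : ℝ) : ℂ) ^ 2 + (h : ℂ) * lam with hmodel
  set H := lam + (κ / 2 : ℝ) * (ℓ₂ + ℓ₁ ^ 2) with hH
  set cross := 2⁻¹ * (ℓ₂ + ℓ₁ ^ 2) * ((2 * Real.sqrt κ * ρ * ΔB * ΔI + ρ ^ 2 * ΔI ^ 2 : ℝ) : ℂ) with hcross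
  have hsplit : model = martPart κ ℓ₁ ℓ₂ ΔB h + H * ((h - Z * ΔI : ℝ) : ℂ) + cross := by
    rw [hmodel, model_split hκ ρ ℓ₁ m₁ ℓ₂ lam ΔB ΔI h, drift_eq hid ΔI h]
  have hdec : (((Y₁ - Y₀ : ℝ)) : ℂ) - Y₀ * martPart κ ℓ₁ ℓ₂ ΔB h =
      (((Y₁ : ℝ) : ℂ) - Y₀ - Y₀ * model) + Y₀ * (H * ((h - Z * ΔI : ℝ) : ℂ) + cross) := by
    rw [hsplit]; push_cast; ring
  have hsq : ‖ℓ₂ + ℓ₁ ^ 2‖ ≤ K + K ^ 2 := (norm_add_le _ _).trans (add_le_add h2 (by rw [norm_pow]; gcongr))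
  have hHn : ‖H‖ ≤ K + κ / 2 * (K + K ^ 2) := by
    rw [hH]
    refine (norm_add_le _ _).trans (add_le_add hl ?_)
    rw [norm_mul, Complex.norm_real, Real.norm_eq_abs, abs_of_nonneg (by positivity : 0 ≤ κ / 2)]
    gcongr
  have hcr : ‖cross‖ ≤ 2⁻¹ * (K + K ^ 2) * (2 * Real.sqrt κ * |ρ| * |ΔB| * ΔI + ρ ^ 2 * ΔI ^ 2) := by
    rw [hcross, norm_mul, norm_mul, Complex.norm_real, Real.norm_eq_abs, norm_inv, Complex.norm_ofNat]
    have habs : |2 * Real.sqrt κ * ρ * ΔB * ΔI + ρ ^ 2 * ΔI ^ 2| ≤ 2 * Real.sqrt κ * |ρ| * |ΔB| * ΔI + ρ ^ 2 * ΔI ^ 2 := by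
      refine (abs_add_le _ _).trans (add_le_add ?_ ?_)
      · rw [abs_mul, abs_mul, abs_mul, abs_mul, abs_of_nonneg (Real.sqrt_nonneg κ), abs_of_nonneg hΔI, abs_two]
      · rw [abs_of_nonneg (by positivity)]
    gcongr
  have hY₀' : ‖((Y₀ : ℝ) : ℂ)‖ ≤ 1 := by rw [Complex.norm_real, Real.norm_eq_abs]; exact hY₀
  rw [hdec]
  calc _ ≤ ‖((Y₁ : ℝ) : ℂ) - Y₀ - Y₀ * model‖ + ‖((Y₀ : ℝ) : ℂ) * (H * ((h - Z * ΔI : ℝ) : ℂ) + cross)‖ := norm_add_le _ _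
    _ ≤ R + 1 * (‖H‖ * |h - Z * ΔI| + ‖cross‖) := by
        gcongr
        · rw [norm_mul]
          gcongr
          refine (norm_add_le _ _).trans (add_le_add (le_of_eq ?_) le_rfl)
          rw [norm_mul, Complex.norm_real, Real.norm_eq_abs]
    _ ≤ _ := by
        rw [one_mul]
        have := abs_nonneg (h - Z * ΔI)
        nlinarith [hHn, hcr, norm_nonneg H]

/-- **Boundary / crude cells**: `|g(Y₁ − Y₀) − g Y₀ martPart| ≤ |Y₁ − Y₀| + martBound` for `g ∈ {0, 1}`,
`|Y₀| ≤ 1`. [folklore] -/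
theorem norm_sub_martPart_le_crude {κ K g Y₀ Y₁ ΔB h : ℝ} (hκ : 0 ≤ κ) (hg : g = 0 ∨ g = 1) (hY₀ : |Y₀| ≤ 1) (hh : 0 ≤ h)
    {ℓ₁ ℓ₂ : ℂ} (h1 : ‖ℓ₁‖ ≤ K) (h2 : ‖ℓ₂‖ ≤ K) :
    ‖(g : ℂ) * (((Y₁ - Y₀ : ℝ)) : ℂ) - g * Y₀ * martPart κ ℓ₁ ℓ₂ ΔB h‖ ≤ |Y₁ - Y₀| + martBound κ K |ΔB| h := by
  have hm := norm_martPart_le hκ h1 h2 ΔB hh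
  rcases hg with rfl | rfl
  · simp only [Complex.ofReal_zero, zero_mul, sub_self, norm_zero]
    have : 0 ≤ martBound κ K |ΔB| h := (norm_nonneg _).trans hm
    positivity
  · simp only [Complex.ofReal_one, one_mul]
    calc _ ≤ ‖(((Y₁ - Y₀ : ℝ)) : ℂ)‖ + ‖((Y₀ : ℝ) : ℂ) * martPart κ ℓ₁ ℓ₂ ΔB h‖ := norm_sub_le _ _
      _ ≤ |Y₁ - Y₀| + 1 * martBound κ K |ΔB| h := by
          rw [Complex.norm_real, Real.norm_eq_abs, norm_mul, Complex.norm_real, Real.norm_eq_abs]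
          gcongr
      _ = _ := by rw [one_mul]

/-- Crude form: `|g(Y₁ − Y₀) − g Y₀ martPart| ≤ 1 + martBound` when `Y₀, Y₁ ∈ [0, 1]`. [folklore] -/
theorem norm_sub_martPart_le_one_add {κ K g Y₀ Y₁ ΔB h : ℝ} (hκ : 0 ≤ κ) (hg : g = 0 ∨ g = 1) (hY₀ : Y₀ ∈ Icc (0 : ℝ) 1)
    (hY₁ : Y₁ ∈ Icc (0 : ℝ) 1) (hh : 0 ≤ h) {ℓ₁ ℓ₂ : ℂ} (h1 : ‖ℓ₁‖ ≤ K) (h2 : ‖ℓ₂‖ ≤ K) :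
    ‖(g : ℂ) * (((Y₁ - Y₀ : ℝ)) : ℂ) - g * Y₀ * martPart κ ℓ₁ ℓ₂ ΔB h‖ ≤ 1 + martBound κ K |ΔB| h := by
  have hY₀' : |Y₀| ≤ 1 := abs_le.2 ⟨by linarith [hY₀.1], hY₀.2⟩
  have hd : |Y₁ - Y₀| ≤ 1 := abs_le.2 ⟨by linarith [hY₁.1, hY₀.2], by linarith [hY₁.2, hY₀.1]⟩
  exact (norm_sub_martPart_le_crude hκ hg hY₀' hh h1 h2).trans (by linarith)

/-- `martBound` is monotone in `dB ≥ 0`. [folklore] -/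
theorem martBound_mono {κ K dB dB' h : ℝ} (hκ : 0 ≤ κ) (hK : 0 ≤ K) (hdB : 0 ≤ dB) (hle : dB ≤ dB') :
    martBound κ K dB h ≤ martBound κ K dB' h := by
  unfold martBound; gcongr

/-- `0 ≤ martBound`. [folklore] -/
theorem martBound_nonneg {κ K dB h : ℝ} (hκ : 0 ≤ κ) (hK : 0 ≤ K) (hdB : 0 ≤ dB) (hh : 0 ≤ h) : 0 ≤ martBound κ K dB h := by
  unfold martBound; positivity

/-! ### The cell scheme -/

/-- **The pathwise one-step expansion of `Y` along one sample** (the deterministic content of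
the Itô expansion of [LSW] Lemma 8.9 along the path `ω`): from every base time `t₁ ≤ τ(ω)`, over a
short step to `t₂` with small oscillation of `W` and small increment of `I`,
`|Y_{t₂} − Y_{t₁} − Y_{t₁}(ℓ₁ x + m₁ a + ½(ℓ₂ + ℓ₁²) x² + h λ)| ≤ K · cellPoly(|x|, |a|, h, S + 4√h)`,
`x = W_{t₂} − W_{t₁}`, `a = −2(I_{t₂} − I_{t₁})`, `h = t₂ − t₁`. A hypothesis bundle on one path.
[cite: LawlerSchrammWerner2003Restriction, proof of Lemma 8.9] -/
structure OneStepPath (K c₀ : ℝ) (Y I W : ℝ≥0 → (ℝ≥0 → ℝ) → ℝ) (ℓ₁ m₁ ℓ₂ lam : ℝ≥0 → (ℝ≥0 → ℝ) → ℂ)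
    (τ : (ℝ≥0 → ℝ) → WithTop ℝ≥0) (ω : ℝ≥0 → ℝ) : Prop where
  le : ∀ (t₁ t₂ : ℝ≥0) (S : ℝ), (t₁ : WithTop ℝ≥0) ≤ τ ω → t₁ < t₂ → (t₂ : ℝ) - t₁ ≤ c₀ →
    (∀ r, t₁ ≤ r → r ≤ t₂ → |W r ω - W t₁ ω| ≤ S) → S ≤ c₀ → I t₂ ω - I t₁ ω ≤ c₀ →
    ‖((Y t₂ ω : ℝ) : ℂ) - Y t₁ ω - Y t₁ ω * (ℓ₁ t₁ ω * ((W t₂ ω - W t₁ ω : ℝ) : ℂ) +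
        m₁ t₁ ω * ((-2 * (I t₂ ω - I t₁ ω) : ℝ) : ℂ) +
        2⁻¹ * (ℓ₂ t₁ ω + ℓ₁ t₁ ω ^ 2) * ((W t₂ ω - W t₁ ω : ℝ) : ℂ) ^ 2 + (((t₂ : ℝ) - t₁ : ℝ) : ℂ) * lam t₁ ω)‖ ≤
      K * cellPoly |W t₂ ω - W t₁ ω| (2 * (I t₂ ω - I t₁ ω)) ((t₂ : ℝ) - t₁) (S + 4 * Real.sqrt ((t₂ : ℝ) - t₁))

/-- **The abstract cell scheme of the conditional-increment proof of [LSW] Lemma 8.9** (a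
hypothesis bundle, not asserted; discharged for [LSW]'s `M_t` in the sequel). On the canonical
space with the canonical Brownian motion `B` and its raw filtration: `Y ∈ [0, 1]` adapted; the clock `I ≥ 0` (continuous non-decreasing paths, adapted) and
`Z = W + 2I`; the driver `W` (continuous paths, adapted, a.s. `= √κ B + ρ I`); a progressive
integrand `J ≥ 0` such that, almost surely, `J` is locally integrable and, up to the stopping
time, `I = ∫ J`, `Z J = 𝟙{Z ≠ 0}` and the zero set of `Z` is Lebesgue-null;
complex adapted jets `ℓ₁, ℓ₂` and jets `m₁, λ`, all bounded by `K` up to (and including) the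
stopping time `τ ≤ T_max`, where also `I, |Z| ≤ K`, the DRIFT IDENTITY
`ρℓ₁ − 2m₁ + Z(λ + (κ/2)(ℓ₂ + ℓ₁²)) = 0` strictly before `τ`; the pathwise ONE-STEP EXPANSION
of `Y` (`OneStepPath`, almost every sample) from every base time `t₁ ≤ τ` over short steps of small
oscillation; and right-continuity of the paths of `Y` at the base times `≤ τ` (every sample).
[cite: LawlerSchrammWerner2003Restriction, Lemma 8.9 and its proof (§8.4)] -/
structure CellScheme (κ ρ K c₀ : ℝ) (Tmax : ℝ≥0) (Y I W J : ℝ≥0 → (ℝ≥0 → ℝ) → ℝ)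
    (ℓ₁ m₁ ℓ₂ lam : ℝ≥0 → (ℝ≥0 → ℝ) → ℂ) (τ : (ℝ≥0 → ℝ) → WithTop ℝ≥0) : Prop where
  κ_pos : 0 < κ
  K_pos : 0 < K
  c₀_pos : 0 < c₀
  c₀_le_one : c₀ ≤ 1
  adapted_Y : Adapted brownianFiltration Y
  adapted_I : Adapted brownianFiltration I
  adapted_W : Adapted brownianFiltration W
  adapted_ℓ₁ : Adapted brownianFiltration ℓ₁
  adapted_ℓ₂ : Adapted brownianFiltration ℓ₂
  isStoppingTime : IsStoppingTime brownianFiltration τ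
  τ_le : ∀ ω, τ ω ≤ Tmax
  Y_mem : ∀ t ω, Y t ω ∈ Icc (0 : ℝ) 1
  continuous_I : ∀ ω, Continuous fun t ↦ I t ω
  monotone_I : ∀ ω, Monotone fun t ↦ I t ω
  I_nonneg : ∀ t ω, 0 ≤ I t ω
  continuous_W : ∀ ω, Continuous fun t ↦ W t ω
  J_nonneg : ∀ t ω, 0 ≤ J t ω
  ae_W : ∀ᵐ ω ∂preWienerMeasure, ∀ t, W t ω = Real.sqrt κ * brownian t ω + ρ * I t ω
  ae_clock : ∀ᵐ ω ∂preWienerMeasure,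
    (∀ T : ℝ≥0, IntervalIntegrable (fun r : ℝ ↦ J r.toNNReal ω) volume 0 T) ∧
    (∀ t : ℝ≥0, ((t : ℝ≥0) : WithTop ℝ≥0) ≤ τ ω →
      I t ω = timeIntegral J t ω ∧ ((W t ω + 2 * I t ω) * J t ω = if W t ω + 2 * I t ω = 0 then 0 else 1)) ∧
    volume {r : ℝ | 0 < r ∧ ((r.toNNReal : ℝ≥0) : WithTop ℝ≥0) ≤ τ ω ∧ W r.toNNReal ω + 2 * I r.toNNReal ω = 0} = 0
  bound : ∀ (t : ℝ≥0) (ω : ℝ≥0 → ℝ), ((t : ℝ≥0) : WithTop ℝ≥0) ≤ τ ω →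
    ‖ℓ₁ t ω‖ ≤ K ∧ ‖m₁ t ω‖ ≤ K ∧ ‖ℓ₂ t ω‖ ≤ K ∧ ‖lam t ω‖ ≤ K ∧ I t ω ≤ K ∧ |W t ω + 2 * I t ω| ≤ K
  ae_identity : ∀ᵐ ω ∂preWienerMeasure, ∀ t : ℝ≥0, ((t : ℝ≥0) : WithTop ℝ≥0) < τ ω →
    (ρ : ℂ) * ℓ₁ t ω - 2 * m₁ t ω + ((W t ω + 2 * I t ω : ℝ) : ℂ) * (lam t ω + (κ / 2 : ℝ) * (ℓ₂ t ω + ℓ₁ t ω ^ 2)) = 0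
  ae_one_step : ∀ᵐ ω ∂preWienerMeasure, OneStepPath K c₀ Y I W ℓ₁ m₁ ℓ₂ lam τ ω
  rightCts : ∀ (ω : ℝ≥0 → ℝ) (t₁ : ℝ≥0), ((t₁ : ℝ≥0) : WithTop ℝ≥0) ≤ τ ω → ContinuousWithinAt (fun r ↦ Y r ω) (Ici t₁) t₁

/-! ### The size of one step -/

/-- The bound on `|Y_{t₂} − Y_{t₁}|` over one step of oscillation `S`, clock increment `≤ dI` and
length `≤ h`: `K S + 2K dI + ½(K + K²)S² + hK + K cellPoly S (2dI) h (S + 4√h)`. [folklore] -/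
def stepBound (K S dI h : ℝ) : ℝ :=
  K * S + 2 * K * dI + 2⁻¹ * (K + K ^ 2) * S ^ 2 + h * K + K * cellPoly S (2 * dI) h (S + 4 * Real.sqrt h)

/-- `0 ≤ stepBound`. [folklore] -/
theorem stepBound_nonneg {K S dI h : ℝ} (hK : 0 ≤ K) (hS : 0 ≤ S) (hd : 0 ≤ dI) (hh : 0 ≤ h) : 0 ≤ stepBound K S dI h := by
  have := cellPoly_nonneg hS (by positivity : 0 ≤ 2 * dI) hh (by positivity : 0 ≤ S + 4 * Real.sqrt h)
  unfold stepBound; positivity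

/-- `stepBound` is monotone in `S, dI, h ≥ 0`. [folklore] -/
theorem stepBound_mono {K S dI h S' dI' h' : ℝ} (hK : 0 ≤ K) (hS : 0 ≤ S) (hd : 0 ≤ dI) (hh : 0 ≤ h)
    (hSS : S ≤ S') (hdd : dI ≤ dI') (hhh : h ≤ h') : stepBound K S dI h ≤ stepBound K S' dI' h' := by
  have hp := cellPoly_mono hS (by positivity : 0 ≤ 2 * dI) hh (by positivity : 0 ≤ S + 4 * Real.sqrt h) hSS
    (by linarith : 2 * dI ≤ 2 * dI') hhh (add_le_add hSS (mul_le_mul_of_nonneg_left (Real.sqrt_le_sqrt hhh) (by norm_num)))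
  unfold stepBound
  have hS' : 0 ≤ S' := hS.trans hSS
  gcongr

/-! ### The terms of the cell bound -/

/-- The boundary term (one cell per path): with `S = √κ osc + |ρ| dI`,
`stepBound K S dI h + martBound κ K osc h`. [folklore] -/
def bdryTerm (κ ρ K osc dI h : ℝ) : ℝ :=
  stepBound K (Real.sqrt κ * osc + |ρ| * dI) dI h + martBound κ K osc h

/-- The interior term: `K cellPoly(|x|, 2dI, h, S + 4√h) + (K + (κ/2)(K + K²))|h − z dI| + ½(K + K²)(2√κ|ρ| dB dI + ρ² dI²)`.
[folklore] -/
def intTerm (κ ρ K osc dB dI x z h : ℝ) : ℝ :=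
  K * cellPoly |x| (2 * dI) h (Real.sqrt κ * osc + |ρ| * dI + 4 * Real.sqrt h) +
    (K + κ / 2 * (K + K ^ 2)) * |h - z * dI| + 2⁻¹ * (K + K ^ 2) * (2 * Real.sqrt κ * |ρ| * dB * dI + ρ ^ 2 * dI ^ 2)

/-- `0 ≤ bdryTerm`. [folklore] -/
theorem bdryTerm_nonneg {κ ρ K osc dI h : ℝ} (hκ : 0 ≤ κ) (hK : 0 ≤ K) (ho : 0 ≤ osc) (hd : 0 ≤ dI) (hh : 0 ≤ h) :
    0 ≤ bdryTerm κ ρ K osc dI h := by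
  have hS : 0 ≤ Real.sqrt κ * osc + |ρ| * dI := by positivity
  have := stepBound_nonneg hK hS hd hh
  have := martBound_nonneg hκ hK ho hh
  unfold bdryTerm; positivity

/-- `0 ≤ intTerm`. [folklore] -/
theorem intTerm_nonneg {κ ρ K osc dB dI x z h : ℝ} (hκ : 0 ≤ κ) (hK : 0 ≤ K) (ho : 0 ≤ osc) (hdB : 0 ≤ dB) (hd : 0 ≤ dI)
    (hh : 0 ≤ h) : 0 ≤ intTerm κ ρ K osc dB dI x z h := by
  have := cellPoly_nonneg (abs_nonneg x) (by positivity : 0 ≤ 2 * dI) hh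
    (by positivity : 0 ≤ Real.sqrt κ * osc + |ρ| * dI + 4 * Real.sqrt h)
  unfold intTerm; positivity

namespace CellScheme

variable {κ ρ K c₀ : ℝ} {Tmax : ℝ≥0} {Y I W J : ℝ≥0 → (ℝ≥0 → ℝ) → ℝ} {ℓ₁ m₁ ℓ₂ lam : ℝ≥0 → (ℝ≥0 → ℝ) → ℂ}
  {τ : (ℝ≥0 → ℝ) → WithTop ℝ≥0} (h𝒮 : CellScheme κ ρ K c₀ Tmax Y I W J ℓ₁ m₁ ℓ₂ lam τ)

/-- The finite value of the stopping time. [folklore] -/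
def τr (h𝒮 : CellScheme κ ρ K c₀ Tmax Y I W J ℓ₁ m₁ ℓ₂ lam τ) (ω : ℝ≥0 → ℝ) : ℝ≥0 := (τ ω).untop (ne_top_of_le_ne_top WithTop.coe_ne_top (h𝒮.τ_le ω))

include h𝒮 in
/-- `τ = τr`. [folklore] -/
theorem τ_eq (ω : ℝ≥0 → ℝ) : τ ω = (h𝒮.τr ω : WithTop ℝ≥0) := (WithTop.coe_untop _ _).symm

include h𝒮 in
/-- **The size of one step of `Y`**: from a base time `t₁ < τ`, over a step to `t₂` of length `≤ h ≤ c₀`,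
oscillation of `W` at most `S ≤ c₀` and clock increment at most `dI ≤ c₀`,
`|Y_{t₂} − Y_{t₁}| ≤ stepBound K S dI h` (the model is `O(S + dI + h)` and the error is the cell
polynomial). In particular `Y` is continuous along `[0, τ]` wherever `W` and `I` are.
[cite: LawlerSchrammWerner2003Restriction, proof of Lemma 8.9] -/
theorem abs_sub_le_stepBound {ω : ℝ≥0 → ℝ} (hpath : OneStepPath K c₀ Y I W ℓ₁ m₁ ℓ₂ lam τ ω) {t₁ t₂ : ℝ≥0} {S dI h : ℝ}
    (hτ : ((t₁ : ℝ≥0) : WithTop ℝ≥0) ≤ τ ω) (h12 : t₁ < t₂)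
    (hh2 : (t₂ : ℝ) - t₁ ≤ h) (hhc : h ≤ c₀) (hW : ∀ r, t₁ ≤ r → r ≤ t₂ → |W r ω - W t₁ ω| ≤ S) (hSc : S ≤ c₀)
    (hI : I t₂ ω - I t₁ ω ≤ dI) (hdI : dI ≤ c₀) :
    |Y t₂ ω - Y t₁ ω| ≤ stepBound K S dI h := by
  have hK := h𝒮.K_pos.le
  obtain ⟨h1, hm1, h2, hl, -, -⟩ := h𝒮.bound t₁ ω hτ
  have hY0 := h𝒮.Y_mem t₁ ω
  have hY0abs : |Y t₁ ω| ≤ 1 := abs_le.2 ⟨by linarith [hY0.1], hY0.2⟩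
  have hstep := hpath.le t₁ t₂ S hτ h12 (hh2.trans hhc) hW hSc (hI.trans hdI)
  have hx : |W t₂ ω - W t₁ ω| ≤ S := hW t₂ h12.le le_rfl
  have hS0 : 0 ≤ S := (abs_nonneg _).trans hx
  have hI0 : 0 ≤ I t₂ ω - I t₁ ω := sub_nonneg.2 (h𝒮.monotone_I ω h12.le)
  have h120 : (0 : ℝ) ≤ (t₂ : ℝ) - t₁ := by
    have : (t₁ : ℝ) ≤ t₂ := by exact_mod_cast h12.le
    linarith
  have hh0 : 0 ≤ h := h120.trans hh2
  set model := ℓ₁ t₁ ω * ((W t₂ ω - W t₁ ω : ℝ) : ℂ) + m₁ t₁ ω * ((-2 * (I t₂ ω - I t₁ ω) : ℝ) : ℂ) +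
      2⁻¹ * (ℓ₂ t₁ ω + ℓ₁ t₁ ω ^ 2) * ((W t₂ ω - W t₁ ω : ℝ) : ℂ) ^ 2 + (((t₂ : ℝ) - t₁ : ℝ) : ℂ) * lam t₁ ω with hmodel
  have hsq : ‖ℓ₂ t₁ ω + ℓ₁ t₁ ω ^ 2‖ ≤ K + K ^ 2 := (norm_add_le _ _).trans (add_le_add h2 (by rw [norm_pow]; gcongr))
  have hmodelb : ‖model‖ ≤ K * S + 2 * K * dI + 2⁻¹ * (K + K ^ 2) * S ^ 2 + h * K := by
    rw [hmodel]
    refine (norm_add_le _ _).trans (add_le_add ((norm_add₃_le).trans (add_le_add (add_le_add ?_ ?_) ?_)) ?_)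
    · rw [norm_mul, Complex.norm_real, Real.norm_eq_abs]; gcongr
    · rw [norm_mul, Complex.norm_real, Real.norm_eq_abs, abs_mul, abs_neg, abs_two, abs_of_nonneg hI0]
      calc ‖m₁ t₁ ω‖ * (2 * (I t₂ ω - I t₁ ω)) ≤ K * (2 * dI) := by gcongr
        _ = 2 * K * dI := by ring
    · rw [norm_mul, norm_mul, norm_inv, Complex.norm_ofNat, norm_pow, Complex.norm_real, Real.norm_eq_abs]
      gcongr
    · rw [norm_mul, Complex.norm_real, Real.norm_eq_abs, abs_of_nonneg h120]
      gcongr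
  have hpoly : cellPoly |W t₂ ω - W t₁ ω| (2 * (I t₂ ω - I t₁ ω)) ((t₂ : ℝ) - t₁) (S + 4 * Real.sqrt ((t₂ : ℝ) - t₁)) ≤
      cellPoly S (2 * dI) h (S + 4 * Real.sqrt h) :=
    cellPoly_mono (abs_nonneg _) (by positivity) h120 (by positivity) hx (by linarith) hh2 (by gcongr)
  have e : (((Y t₂ ω - Y t₁ ω : ℝ)) : ℂ) = (((Y t₂ ω : ℝ) : ℂ) - Y t₁ ω - Y t₁ ω * model) + Y t₁ ω * model := by push_cast; ring
  have hn : |Y t₂ ω - Y t₁ ω| = ‖(((Y t₂ ω - Y t₁ ω : ℝ)) : ℂ)‖ := by rw [Complex.norm_real, Real.norm_eq_abs]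
  rw [hn, e, stepBound]
  calc _ ≤ ‖((Y t₂ ω : ℝ) : ℂ) - Y t₁ ω - Y t₁ ω * model‖ + ‖((Y t₁ ω : ℝ) : ℂ) * model‖ := norm_add_le _ _
    _ ≤ K * cellPoly S (2 * dI) h (S + 4 * Real.sqrt h) + 1 * (K * S + 2 * K * dI + 2⁻¹ * (K + K ^ 2) * S ^ 2 + h * K) := by
        gcongr
        · exact hstep.trans (mul_le_mul_of_nonneg_left hpoly hK)
        · rw [norm_mul, Complex.norm_real, Real.norm_eq_abs]
          exact mul_le_mul hY0abs hmodelb (norm_nonneg _) zero_le_one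
    _ = _ := by ring

/-! ### Continuity of the paths of `Y` up to `τ`, and adaptedness of `Y^τ` -/

omit h𝒮 in
/-- `stepBound K S dI h → 0` as `(S, dI, h) → 0⁺`. [folklore] -/
theorem tendsto_stepBound (K : ℝ) :
    Tendsto (fun p : ℝ × ℝ × ℝ ↦ stepBound K p.1 p.2.1 p.2.2) (𝓝[{p | 0 ≤ p.2.2}] (0, 0, 0)) (𝓝 0) := by
  have hc : ContinuousWithinAt (fun p : ℝ × ℝ × ℝ ↦ stepBound K p.1 p.2.1 p.2.2) {p | 0 ≤ p.2.2} (0, 0, 0) := by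
    unfold stepBound cellPoly
    fun_prop
  have h0 : stepBound K 0 0 0 = 0 := by simp [stepBound, cellPoly]
  simpa [h0] using hc.tendsto

include h𝒮 in
/-- **Modulus of continuity of `Y` at base times `t₁ ≤ τ`**: for every `ε > 0` there is `η > 0`
such that `|Y_{t₂} − Y_{t₁}| < ε` whenever `t₁ ≤ τ`, `t₁ < t₂`, `t₂ − t₁ ≤ η`, the oscillation of `W`
on `[t₁, t₂]` is `≤ η` and `I_{t₂} − I_{t₁} ≤ η`. [folklore] -/
theorem exists_modulus {ε : ℝ} (hε : 0 < ε) :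
    ∃ η > 0, ∀ ω, OneStepPath K c₀ Y I W ℓ₁ m₁ ℓ₂ lam τ ω → ∀ (t₁ t₂ : ℝ≥0), ((t₁ : ℝ≥0) : WithTop ℝ≥0) ≤ τ ω → t₁ < t₂ →
      (t₂ : ℝ) - t₁ ≤ η → (∀ r, t₁ ≤ r → r ≤ t₂ → |W r ω - W t₁ ω| ≤ η) → I t₂ ω - I t₁ ω ≤ η →
      |Y t₂ ω - Y t₁ ω| < ε := by
  have h := tendsto_stepBound K
  have hev : ∀ᶠ p : ℝ × ℝ × ℝ in 𝓝[{p | 0 ≤ p.2.2}] (0, 0, 0), stepBound K p.1 p.2.1 p.2.2 < ε := h (Iio_mem_nhds hε)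
  rw [eventually_nhdsWithin_iff, Metric.eventually_nhds_iff] at hev
  obtain ⟨δ, hδ, hδε⟩ := hev
  refine ⟨min (δ / 2) c₀, lt_min (by positivity) h𝒮.c₀_pos, fun ω hpath t₁ t₂ hτ h12 hh hW hI ↦ ?_⟩
  set η := min (δ / 2) c₀ with hη
  have hηc : η ≤ c₀ := min_le_right _ _
  have hηδ : η ≤ δ / 2 := min_le_left _ _
  have hη0 : 0 < η := lt_min (by positivity) h𝒮.c₀_pos
  have hb := h𝒮.abs_sub_le_stepBound hpath hτ h12 hh hηc hW hηc hI hηc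
  refine hb.trans_lt (hδε ?_ (show (0 : ℝ) ≤ (η, η, η).2.2 from hη0.le))
  rw [dist_eq_norm, Prod.norm_def, Prod.norm_def]
  simp only [Prod.fst_sub, Prod.snd_sub, sub_zero, Real.norm_eq_abs, abs_of_pos hη0, max_self]
  linarith

include h𝒮 in
/-- **Right-continuity of `Y` at every base time `t₁ ≤ τ`** (in particular at `τ` itself): a field
of the scheme. [folklore] -/
theorem continuousWithinAt_Ici {ω : ℝ≥0 → ℝ} {t₁ : ℝ≥0} (hτ : ((t₁ : ℝ≥0) : WithTop ℝ≥0) ≤ τ ω) :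
    ContinuousWithinAt (fun r ↦ Y r ω) (Ici t₁) t₁ :=
  h𝒮.rightCts ω t₁ hτ

include h𝒮 in
/-- **The stopped process `Y^τ` is adapted**: it is the pointwise limit of the values of `Y` at the
capped dyadic upper approximations `t ∧ τₖ` of the stopping time (each measurable for `𝓕_t` by
countability of the range), thanks to the right-continuity of `Y` at `τ`.
[cite: RevuzYor1999, Ch. I §4 (approximation of stopping times)] -/
theorem adapted_stoppedProcess : Adapted brownianFiltration (stoppedProcess Y τ) := by
  intro t
  have hτ := h𝒮.isStoppingTime
  have hYs : StronglyAdapted brownianFiltration Y := fun r ↦ (h𝒮.adapted_Y r).stronglyMeasurable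
  set σk : ℕ → (ℝ≥0 → ℝ) → WithTop ℝ≥0 := fun k ω ↦ dyadicCeilTop k (τ ω) with hσk
  have hσ : ∀ k, IsStoppingTime brownianFiltration (fun ω ↦ min (t : WithTop ℝ≥0) (σk k ω)) := fun k ↦
    (isStoppingTime_const _ t).min (hτ.isOptionalTime.isStoppingTime_dyadicCeilTop k)
  have hle : ∀ k ω, min (t : WithTop ℝ≥0) (σk k ω) ≤ t := fun k ω ↦ min_le_left _ _
  have hcount : ∀ k, (Set.range fun ω ↦ min (t : WithTop ℝ≥0) (σk k ω)).Countable := by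
    intro k
    refine ((countable_range_dyadicCeilTop k).insert (t : WithTop ℝ≥0)).mono ?_
    rintro _ ⟨ω, rfl⟩
    change min (t : WithTop ℝ≥0) (σk k ω) ∈ _
    rcases min_choice (t : WithTop ℝ≥0) (σk k ω) with h | h
    · rw [h]; exact Set.mem_insert _ _
    · rw [h]; exact Set.mem_insert_of_mem _ ⟨τ ω, rfl⟩
  have hmeas : ∀ k, StronglyMeasurable[brownianFiltration t] (stoppedValue Y fun ω ↦ min (t : WithTop ℝ≥0) (σk k ω)) :=
    fun k ↦ stronglyMeasurable_stoppedValue_of_countable_range hYs (hσ k) (hcount k) (hle k)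
  -- pointwise convergence to the stopped process
  have hlim : ∀ ω, Tendsto (fun k ↦ stoppedValue Y (fun ω ↦ min (t : WithTop ℝ≥0) (σk k ω)) ω) atTop
      (𝓝 (stoppedProcess Y τ t ω)) := by
    intro ω
    simp only [stoppedValue, stoppedProcess]
    set T := h𝒮.τr ω with hT
    have hτT : τ ω = (T : WithTop ℝ≥0) := h𝒮.τ_eq ω
    -- the capped times converge from the right to `min t T`
    have hconv := tendsto_untopA_min_dyadicCeilTop t (τ ω)
    have hmin : (min (t : WithTop ℝ≥0) (τ ω)).untopA = min t T := by
      rw [hτT, ← WithTop.coe_min]; rfl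
    rw [hmin] at hconv ⊢
    have hge : ∀ k, min t T ≤ (min (t : WithTop ℝ≥0) (σk k ω)).untopA := by
      intro k
      have h1 : min (t : WithTop ℝ≥0) (τ ω) ≤ min (t : WithTop ℝ≥0) (σk k ω) := min_le_min le_rfl (le_dyadicCeilTop k _)
      have hne : min (t : WithTop ℝ≥0) (σk k ω) ≠ ⊤ := ne_top_of_le_ne_top WithTop.coe_ne_top (min_le_left _ _)
      obtain ⟨v, hv⟩ := WithTop.ne_top_iff_exists.1 hne
      rw [← hv, WithTop.untopA, WithTop.untopD_coe]
      rw [← hv, hτT, ← WithTop.coe_min, WithTop.coe_le_coe] at h1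
      exact h1
    -- right-continuity of `Y` at `min t T ≤ τ`
    have hbase : ((min t T : ℝ≥0) : WithTop ℝ≥0) ≤ τ ω := by rw [hτT]; exact_mod_cast min_le_right t T
    have hrc := h𝒮.continuousWithinAt_Ici (ω := ω) hbase
    exact hrc.tendsto.comp (tendsto_nhdsWithin_iff.2 ⟨hconv, Eventually.of_forall hge⟩)
  exact (stronglyMeasurable_of_tendsto atTop hmeas (tendsto_pi_nhds.2 hlim)).measurable

include h𝒮 in
/-- **The paths of the stopped process `Y^τ` are continuous along every sample satisfying the
one-step expansion**: left- and right-continuity at every time `≤ τ` follow from the one-step bound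
and the continuity of `W` and `I`; after `τ` the stopped process is constant. [folklore] -/
theorem continuous_stoppedProcess {ω : ℝ≥0 → ℝ} (hpath : OneStepPath K c₀ Y I W ℓ₁ m₁ ℓ₂ lam τ ω) :
    Continuous fun r ↦ stoppedProcess Y τ r ω := by
  set T := h𝒮.τr ω with hT
  have hτT : τ ω = (T : WithTop ℝ≥0) := h𝒮.τ_eq ω
  have hX : ∀ r, stoppedProcess Y τ r ω = Y (min r T) ω := by
    intro r
    simp only [stoppedProcess, hτT, ← WithTop.coe_min]; rfl
  simp_rw [hX]
  -- it suffices: `r ↦ Y r ω` is continuous on `Iic T`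
  suffices hcts : ContinuousOn (fun r ↦ Y r ω) (Iic T) from
    hcts.comp_continuous (continuous_id.min continuous_const) fun r ↦ min_le_right r T
  intro r₀ hr₀
  rw [Metric.continuousWithinAt_iff]
  intro ε hε
  obtain ⟨η, hη, hmod⟩ := h𝒮.exists_modulus (half_pos hε)
  obtain ⟨δ₁, hδ₁, hWδ⟩ := Metric.continuousAt_iff.1 ((h𝒮.continuous_W ω).continuousAt (x := r₀)) (η / 2) (by positivity)
  obtain ⟨δ₂, hδ₂, hIδ⟩ := Metric.continuousAt_iff.1 ((h𝒮.continuous_I ω).continuousAt (x := r₀)) (η / 2) (by positivity)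
  refine ⟨min η (min δ₁ δ₂), lt_min hη (lt_min hδ₁ hδ₂), fun r hr hdist ↦ ?_⟩
  have hrT : r ≤ T := hr
  have hdη : dist r r₀ < η := hdist.trans_le (min_le_left _ _)
  have hd₁ : dist r r₀ < δ₁ := hdist.trans_le ((min_le_right _ _).trans (min_le_left _ _))
  have hd₂ : dist r r₀ < δ₂ := hdist.trans_le ((min_le_right _ _).trans (min_le_right _ _))
  -- oscillation bounds around `r₀`
  have hWb : ∀ r', dist r' r₀ < δ₁ → |W r' ω - W r₀ ω| < η / 2 := fun r' h ↦ by
    have := hWδ h; rwa [Real.dist_eq] at this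
  have hIb : ∀ r', dist r' r₀ < δ₂ → |I r' ω - I r₀ ω| < η / 2 := fun r' h ↦ by
    have := hIδ h; rwa [Real.dist_eq] at this
  rcases lt_trichotomy r r₀ with hlt | heq | hgt
  · -- `r < r₀ ≤ T`: base point `r`
    have hbase : ((r : ℝ≥0) : WithTop ℝ≥0) ≤ τ ω := by rw [hτT]; exact_mod_cast hrT
    have hrr₀ : (r : ℝ) ≤ r₀ := by exact_mod_cast hlt.le
    have hh : (r₀ : ℝ) - r ≤ η := by
      rw [NNReal.dist_eq, abs_sub_comm, abs_of_nonneg (by linarith)] at hdη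
      exact hdη.le
    have hW' : ∀ r', r ≤ r' → r' ≤ r₀ → |W r' ω - W r ω| ≤ η := by
      intro r' h1 h2
      have e1 : (r' : ℝ) ≤ r₀ := by exact_mod_cast h2
      have e2 : (r : ℝ) ≤ r' := by exact_mod_cast h1
      have hd' : dist r' r₀ < δ₁ := by
        rw [NNReal.dist_eq, abs_sub_comm, abs_of_nonneg (by linarith)]
        rw [NNReal.dist_eq, abs_sub_comm, abs_of_nonneg (by linarith)] at hd₁
        linarith
      have e : W r' ω - W r ω = (W r' ω - W r₀ ω) - (W r ω - W r₀ ω) := by ring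
      rw [e]
      have := hWb r' hd'
      have := hWb r hd₁
      calc |W r' ω - W r₀ ω - (W r ω - W r₀ ω)| ≤ |W r' ω - W r₀ ω| + |W r ω - W r₀ ω| := abs_sub _ _
        _ ≤ η := by linarith
    have hI' : I r₀ ω - I r ω ≤ η := by
      have := hIb r hd₂
      have := neg_abs_le (I r ω - I r₀ ω)
      linarith
    have := hmod ω hpath r r₀ hbase hlt hh hW' hI'
    rw [Real.dist_eq, abs_sub_comm]; linarith
  · subst heq; simpa using hε
  · -- `r₀ < r ≤ T`: base point `r₀`
    have hbase : ((r₀ : ℝ≥0) : WithTop ℝ≥0) ≤ τ ω := by rw [hτT]; exact_mod_cast (show r₀ ∈ Iic T from hr₀)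
    have hr₀r : (r₀ : ℝ) ≤ r := by exact_mod_cast hgt.le
    have hh : (r : ℝ) - r₀ ≤ η := by
      rw [NNReal.dist_eq, abs_of_nonneg (by linarith)] at hdη
      exact hdη.le
    have hW' : ∀ r', r₀ ≤ r' → r' ≤ r → |W r' ω - W r₀ ω| ≤ η := by
      intro r' h1 h2
      have e1 : (r₀ : ℝ) ≤ r' := by exact_mod_cast h1
      have e2 : (r' : ℝ) ≤ r := by exact_mod_cast h2
      have hd' : dist r' r₀ < δ₁ := by
        rw [NNReal.dist_eq, abs_of_nonneg (by linarith)]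
        rw [NNReal.dist_eq, abs_of_nonneg (by linarith)] at hd₁
        linarith
      exact (hWb r' hd').le.trans (by linarith)
    have hI' : I r ω - I r₀ ω ≤ η := by
      have := hIb r hd₂
      exact ((le_abs_self _).trans this.le).trans (by linarith)
    have := hmod ω hpath r₀ r hbase hgt hh hW' hI'
    rw [Real.dist_eq]; linarith

include h𝒮 in
/-- **Almost every path of the stopped process `Y^τ` is continuous.** [folklore] -/
theorem ae_continuous_stoppedProcess :
    ∀ᵐ ω ∂preWienerMeasure, Continuous fun r ↦ stoppedProcess Y τ r ω := by
  filter_upwards [h𝒮.ae_one_step] with ω hpath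
  exact h𝒮.continuous_stoppedProcess hpath

/-! ### The bound on one cell -/

include h𝒮 in
/-- **The pointwise bound on one cell.** For a sample on which `W = √κ B + ρ I`, a cell `[u, u + hh]`
of length `hh ≤ c₀`, thresholds `c₁, θ > 0` with `√κ c₁ + |ρ| θ ≤ c₀`, `θ ≤ c₀`, and a weight
`g ∈ {0, 1}` vanishing unless `u < τ`, the tested stopped increment minus its martingale part is
bounded by the sum of: the crude bound on the cells of large Brownian oscillation `osc ≥ c₁`; the
constant bound on the cells of large clock increment `ΔI > θ`; the boundary term if `τ` falls inside
the cell; the interior term otherwise (one-step expansion + drift identity).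
[cite: LawlerSchrammWerner2003Restriction, proof of Lemma 8.9] -/
theorem norm_cell_sub_martPart_le {ω : ℝ≥0 → ℝ} (hω : ∀ t, W t ω = Real.sqrt κ * brownian t ω + ρ * I t ω)
    (hpath : OneStepPath K c₀ Y I W ℓ₁ m₁ ℓ₂ lam τ ω)
    (hid : ∀ t : ℝ≥0, ((t : ℝ≥0) : WithTop ℝ≥0) < τ ω →
      (ρ : ℂ) * ℓ₁ t ω - 2 * m₁ t ω + ((W t ω + 2 * I t ω : ℝ) : ℂ) * (lam t ω + (κ / 2 : ℝ) * (ℓ₂ t ω + ℓ₁ t ω ^ 2)) = 0)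
    {u hh : ℝ≥0} (hh0 : 0 < hh) (hhc : (hh : ℝ) ≤ c₀) {c₁ θ : ℝ} (hc₁ : 0 < c₁)
    (hcθ : Real.sqrt κ * c₁ + |ρ| * θ ≤ c₀) (hθc : θ ≤ c₀) {g : ℝ} (hg : g = 0 ∨ g = 1)
    (hgτ : g ≠ 0 → (u : WithTop ℝ≥0) < τ ω) :
    ‖(g : ℂ) * (((stoppedProcess Y τ (u + hh) ω - stoppedProcess Y τ u ω : ℝ)) : ℂ) -
        g * Y u ω * martPart κ (ℓ₁ u ω) (ℓ₂ u ω) (brownian (u + hh) ω - brownian u ω) hh‖ ≤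
      (if c₁ ≤ incRunSup u hh ω then 1 + martBound κ K |brownian (u + hh) ω - brownian u ω| hh else 0) +
      (if (u : WithTop ℝ≥0) < τ ω ∧ incRunSup u hh ω < c₁ ∧ θ < I (u + hh) ω - I u ω then 1 + martBound κ K c₁ hh else 0) +
      (if (u : WithTop ℝ≥0) < τ ω ∧ incRunSup u hh ω < c₁ ∧ I (u + hh) ω - I u ω ≤ θ ∧ τ ω < ((u + hh : ℝ≥0) : WithTop ℝ≥0) then
          bdryTerm κ ρ K (incRunSup u hh ω) (I (u + hh) ω - I u ω) hh else 0) +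
      (if (u : WithTop ℝ≥0) < τ ω ∧ incRunSup u hh ω < c₁ ∧ I (u + hh) ω - I u ω ≤ θ ∧ ((u + hh : ℝ≥0) : WithTop ℝ≥0) ≤ τ ω then
          intTerm κ ρ K (incRunSup u hh ω) |brownian (u + hh) ω - brownian u ω| (I (u + hh) ω - I u ω)
            (W (u + hh) ω - W u ω) (W u ω + 2 * I u ω) hh else 0) := by
  have hκ := h𝒮.κ_pos.le
  have hK := h𝒮.K_pos.le
  set osc := incRunSup u hh ω with hosc
  set ΔB := brownian (u + hh) ω - brownian u ω with hΔB
  set ΔI := I (u + hh) ω - I u ω with hΔI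
  have hosc0 : 0 ≤ osc := incRunSup_nonneg u hh ω
  have hΔI0 : 0 ≤ ΔI := sub_nonneg.2 (h𝒮.monotone_I ω le_self_add)
  have hΔBosc : |ΔB| ≤ osc := abs_incr_le_incRunSup le_rfl ω
  have hhh0 : (0 : ℝ) ≤ hh := hh.coe_nonneg
  -- nonnegativity of the four terms
  have hT1 : 0 ≤ (if c₁ ≤ osc then 1 + martBound κ K |ΔB| hh else 0) := by
    split_ifs
    · have := martBound_nonneg hκ hK (abs_nonneg ΔB) hhh0; linarith
    · exact le_rfl
  have hT2 : 0 ≤ (if (u : WithTop ℝ≥0) < τ ω ∧ osc < c₁ ∧ θ < ΔI then 1 + martBound κ K c₁ hh else 0) := by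
    split_ifs
    · have := martBound_nonneg hκ hK hc₁.le hhh0; linarith
    · exact le_rfl
  have hT3 : 0 ≤ (if (u : WithTop ℝ≥0) < τ ω ∧ osc < c₁ ∧ ΔI ≤ θ ∧ τ ω < ((u + hh : ℝ≥0) : WithTop ℝ≥0) then
      bdryTerm κ ρ K osc ΔI hh else 0) := by
    split_ifs
    · exact bdryTerm_nonneg hκ hK hosc0 hΔI0 hhh0
    · exact le_rfl
  have hT4 : 0 ≤ (if (u : WithTop ℝ≥0) < τ ω ∧ osc < c₁ ∧ ΔI ≤ θ ∧ ((u + hh : ℝ≥0) : WithTop ℝ≥0) ≤ τ ω then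
      intTerm κ ρ K osc |ΔB| ΔI (W (u + hh) ω - W u ω) (W u ω + 2 * I u ω) hh else 0) := by
    split_ifs
    · exact intTerm_nonneg hκ hK hosc0 (abs_nonneg ΔB) hΔI0 hhh0
    · exact le_rfl
  -- the trivial case `g = 0`
  by_cases hg0 : g = 0
  · rw [hg0]; simp only [Complex.ofReal_zero, zero_mul, sub_self, norm_zero]; positivity
  have huτ : (u : WithTop ℝ≥0) < τ ω := hgτ hg0
  obtain ⟨h1, hm1, h2, hl, hIK, hZK⟩ := h𝒮.bound u ω huτ.le
  have hY0 := h𝒮.Y_mem u ω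
  have hstop_u : stoppedProcess Y τ u ω = Y u ω := stoppedProcess_eq_of_le huτ.le
  rw [hstop_u]
  -- the oscillation of `W` over the cell
  set S := Real.sqrt κ * osc + |ρ| * ΔI with hS
  have hWosc : ∀ r, u ≤ r → r ≤ u + hh → |W r ω - W u ω| ≤ S := by
    intro r hr1 hr2
    obtain ⟨v, rfl⟩ : ∃ v, r = u + v := ⟨r - u, (add_tsub_cancel_of_le hr1).symm⟩
    have hv : v ≤ hh := le_of_add_le_add_left hr2
    rw [hω (u + v), hω u]
    have hB : |brownian (u + v) ω - brownian u ω| ≤ osc := abs_incr_le_incRunSup hv ω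
    have hI1 : 0 ≤ I (u + v) ω - I u ω := sub_nonneg.2 (h𝒮.monotone_I ω le_self_add)
    have huv : u + v ≤ u + hh := add_le_add le_rfl hv
    have hI2 : I (u + v) ω - I u ω ≤ ΔI := sub_le_sub_right (h𝒮.monotone_I ω huv) _
    calc |Real.sqrt κ * brownian (u + v) ω + ρ * I (u + v) ω - (Real.sqrt κ * brownian u ω + ρ * I u ω)|
        = |Real.sqrt κ * (brownian (u + v) ω - brownian u ω) + ρ * (I (u + v) ω - I u ω)| := by ring_nf
      _ ≤ |Real.sqrt κ * (brownian (u + v) ω - brownian u ω)| + |ρ * (I (u + v) ω - I u ω)| := abs_add_le _ _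
      _ ≤ Real.sqrt κ * osc + |ρ| * ΔI := by
          rw [abs_mul, abs_mul, abs_of_nonneg (Real.sqrt_nonneg κ), abs_of_nonneg hI1]
          gcongr
  -- case analysis
  by_cases hbad : c₁ ≤ osc
  · -- large Brownian oscillation: crude bound
    have hY1 : stoppedProcess Y τ (u + hh) ω ∈ Icc (0 : ℝ) 1 := h𝒮.Y_mem _ ω
    have := norm_sub_martPart_le_one_add (ΔB := ΔB) (h := (hh : ℝ)) hκ hg hY0 hY1 hhh0 h1 h2
    rw [if_pos hbad]
    linarith
  have hgood : osc < c₁ := not_le.1 hbad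
  rw [if_neg hbad, zero_add]
  by_cases hIbad : θ < ΔI
  · -- large clock increment: crude bound, `|ΔB| ≤ osc < c₁`
    have hY1 : stoppedProcess Y τ (u + hh) ω ∈ Icc (0 : ℝ) 1 := h𝒮.Y_mem _ ω
    have h0 := norm_sub_martPart_le_one_add (ΔB := ΔB) (h := (hh : ℝ)) hκ hg hY0 hY1 hhh0 h1 h2
    have hmono := martBound_mono (h := (hh : ℝ)) hκ hK (abs_nonneg ΔB) (hΔBosc.trans hgood.le)
    rw [if_pos ⟨huτ, hgood, hIbad⟩]
    linarith
  have hIgood : ΔI ≤ θ := not_lt.1 hIbad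
  rw [if_neg (fun h ↦ hIbad h.2.2), zero_add]
  have hSc : S ≤ c₀ := by
    rw [hS]
    calc Real.sqrt κ * osc + |ρ| * ΔI ≤ Real.sqrt κ * c₁ + |ρ| * θ := by gcongr
      _ ≤ c₀ := hcθ
  have hY0abs : |Y u ω| ≤ 1 := abs_le.2 ⟨by linarith [hY0.1], hY0.2⟩
  by_cases hbdry : τ ω < ((u + hh : ℝ≥0) : WithTop ℝ≥0)
  · -- the boundary cell: one step from `u` to `τ`
    rw [if_pos ⟨huτ, hgood, hIgood, hbdry⟩, if_neg (fun h ↦ absurd (hbdry.trans_le h.2.2.2) (lt_irrefl _)), add_zero]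
    set T := h𝒮.τr ω with hT
    have hτT : τ ω = (T : WithTop ℝ≥0) := h𝒮.τ_eq ω
    have huT : u < T := by have := huτ; rw [hτT] at this; exact_mod_cast this
    have hTu : T < u + hh := by have := hbdry; rw [hτT] at this; exact_mod_cast this
    have hstop : stoppedProcess Y τ (u + hh) ω = Y T ω := by
      rw [stoppedProcess_eq_of_ge hbdry.le, hτT]; rfl
    rw [hstop]
    have hΔI' : I T ω - I u ω ≤ ΔI := sub_le_sub_right (h𝒮.monotone_I ω hTu.le) _
    have hTuh : (T : ℝ) ≤ u + hh := by exact_mod_cast hTu.le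
    have hTh : (T : ℝ) - u ≤ hh := by linarith
    have hD : |Y T ω - Y u ω| ≤ stepBound K S ΔI hh :=
      h𝒮.abs_sub_le_stepBound hpath (by rw [hτT]; exact_mod_cast huT.le) huT hTh hhc
        (fun r hr1 hr2 ↦ hWosc r hr1 (hr2.trans hTu.le)) hSc hΔI' (hIgood.trans hθc)
    have hcr := norm_sub_martPart_le_crude (Y₁ := Y T ω) (ΔB := ΔB) (h := (hh : ℝ)) hκ hg hY0abs hhh0 h1 h2
    have hmono := martBound_mono (h := (hh : ℝ)) hκ hK (abs_nonneg ΔB) hΔBosc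
    have hgoal : |Y T ω - Y u ω| + martBound κ K |ΔB| hh ≤ bdryTerm κ ρ K osc ΔI hh := by
      unfold bdryTerm; rw [← hS]; linarith
    exact hcr.trans hgoal
  · -- an interior cell: one step from `u` to `u + hh` and the drift identity
    have hle : ((u + hh : ℝ≥0) : WithTop ℝ≥0) ≤ τ ω := not_lt.1 hbdry
    rw [if_neg (fun h ↦ hbdry h.2.2.2), zero_add, if_pos ⟨huτ, hgood, hIgood, hle⟩]
    have hstop : stoppedProcess Y τ (u + hh) ω = Y (u + hh) ω := stoppedProcess_eq_of_le hle
    rw [hstop]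
    have hhh : ((u + hh : ℝ≥0) : ℝ) - u = hh := by push_cast; ring
    have hstep := hpath.le u (u + hh) S huτ.le (lt_add_of_pos_right u hh0) (by rw [hhh]; exact hhc) hWosc hSc
      (hIgood.trans hθc)
    rw [hhh] at hstep
    have hx : W (u + hh) ω - W u ω = Real.sqrt κ * ΔB + ρ * ΔI := by rw [hω, hω, hΔB, hΔI]; ring
    have ha : -2 * (I (u + hh) ω - I u ω) = -2 * ΔI := by rw [hΔI]
    rw [hx, ha] at hstep
    have hid := hid u huτ
    have key := norm_sub_martPart_le_interior (Y₁ := Y (u + hh) ω) hκ hY0abs hΔI0 h1 h2 hl hid hstep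
    have key' : ‖(((Y (u + hh) ω - Y u ω : ℝ)) : ℂ) - Y u ω * martPart κ (ℓ₁ u ω) (ℓ₂ u ω) ΔB hh‖ ≤
        intTerm κ ρ K osc |ΔB| ΔI (W (u + hh) ω - W u ω) (W u ω + 2 * I u ω) hh := by
      unfold intTerm; rw [hx, ← hS]; exact key
    rcases hg with rfl | rfl
    · exact absurd rfl hg0
    simpa only [Complex.ofReal_one, one_mul] using key'

end CellScheme

/-! ### Monotonicity and linear size of the boundary term -/

/-- `bdryTerm` is monotone in `osc, dI, h ≥ 0`. [folklore] -/
theorem bdryTerm_mono {κ ρ K osc dI h osc' dI' h' : ℝ} (hκ : 0 ≤ κ) (hK : 0 ≤ K) (ho : 0 ≤ osc) (hd : 0 ≤ dI) (hh : 0 ≤ h)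
    (hoo : osc ≤ osc') (hdd : dI ≤ dI') (hhh : h ≤ h') : bdryTerm κ ρ K osc dI h ≤ bdryTerm κ ρ K osc' dI' h' := by
  have hS : 0 ≤ Real.sqrt κ * osc + |ρ| * dI := by positivity
  have hSS : Real.sqrt κ * osc + |ρ| * dI ≤ Real.sqrt κ * osc' + |ρ| * dI' := by gcongr
  have h1 := stepBound_mono hK hS hd hh hSS hdd hhh
  have h2 : martBound κ K osc h ≤ martBound κ K osc' h' := by
    unfold martBound; have : 0 ≤ osc' := ho.trans hoo; gcongr
  unfold bdryTerm; linarith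

/-- The linear constant of the boundary term: `bdryTerm κ ρ K δ δ δ² ≤ bdryC · δ` for `δ ≤ 1`. [folklore] -/
def bdryC (κ ρ K : ℝ) : ℝ :=
  K * (Real.sqrt κ + |ρ|) + 2 * K + 2⁻¹ * (K + K ^ 2) * (Real.sqrt κ + |ρ|) ^ 2 + K +
    K * ((Real.sqrt κ + |ρ| + 4) + 1 + (Real.sqrt κ + |ρ|) ^ 3 + 4 + 2 * (Real.sqrt κ + |ρ|) + 2 + (Real.sqrt κ + |ρ|)) +
    (Real.sqrt κ * K + κ / 2 * (K + K ^ 2) * 2)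

/-- **`bdryTerm κ ρ K δ δ δ² ≤ bdryC · δ`** for `0 ≤ δ ≤ 1`. [folklore] -/
theorem bdryTerm_le_linear {κ ρ K δ : ℝ} (hκ : 0 ≤ κ) (hK : 0 ≤ K) (hδ : 0 ≤ δ) (hδ1 : δ ≤ 1) :
    bdryTerm κ ρ K δ δ (δ ^ 2) ≤ bdryC κ ρ K * δ := by
  set c := Real.sqrt κ + |ρ| with hc
  have hc0 : 0 ≤ c := by positivity
  have hS : Real.sqrt κ * δ + |ρ| * δ = c * δ := by rw [hc]; ring
  have hsq : Real.sqrt (δ ^ 2) = δ := Real.sqrt_sq hδ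
  have hδ2 : δ ^ 2 ≤ δ := by nlinarith
  have hδ3 : δ ^ 3 ≤ δ := by nlinarith
  have hcδ : c * δ ≤ c := mul_le_of_le_one_right hc0 hδ1
  -- the polynomial part
  have hpoly : cellPoly (c * δ) (2 * δ) (δ ^ 2) (c * δ + 4 * δ) ≤ ((c + 4) + 1 + c ^ 3 + 4 + 2 * c + 2 + c) * δ := by
    unfold cellPoly
    have t1 : δ ^ 2 * (c * δ + 4 * δ) ≤ (c + 4) * δ := by nlinarith [mul_nonneg hc0 hδ]
    have t2 : (δ ^ 2) ^ 2 ≤ 1 * δ := by nlinarith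
    have t3 : (c * δ) ^ 3 ≤ c ^ 3 * δ := by
      rw [mul_pow]; exact mul_le_mul_of_nonneg_left hδ3 (by positivity)
    have t4 : (2 * δ) ^ 2 ≤ 4 * δ := by nlinarith
    have t5 : 2 * δ * (c * δ) ≤ 2 * c * δ := by nlinarith [mul_nonneg hc0 hδ]
    have t6 : δ ^ 2 * (2 * δ) ≤ 2 * δ := by nlinarith
    have t7 : δ ^ 2 * (c * δ) ≤ c * δ := by nlinarith [mul_nonneg hc0 hδ]
    nlinarith
  have hstep : stepBound K (c * δ) δ (δ ^ 2) ≤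
      (K * c + 2 * K + 2⁻¹ * (K + K ^ 2) * c ^ 2 + K + K * ((c + 4) + 1 + c ^ 3 + 4 + 2 * c + 2 + c)) * δ := by
    unfold stepBound
    rw [hsq]
    have e1 : K * (c * δ) = K * c * δ := by ring
    have e2 : 2⁻¹ * (K + K ^ 2) * (c * δ) ^ 2 ≤ 2⁻¹ * (K + K ^ 2) * c ^ 2 * δ := by
      have : (c * δ) ^ 2 ≤ c ^ 2 * δ := by rw [mul_pow]; exact mul_le_mul_of_nonneg_left hδ2 (by positivity)
      nlinarith [mul_nonneg (by positivity : (0 : ℝ) ≤ 2⁻¹ * (K + K ^ 2)) (by positivity : (0 : ℝ) ≤ c ^ 2 * δ)]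
    have e3 : δ ^ 2 * K ≤ K * δ := by nlinarith
    have e4 : K * cellPoly (c * δ) (2 * δ) (δ ^ 2) (c * δ + 4 * δ) ≤ K * (((c + 4) + 1 + c ^ 3 + 4 + 2 * c + 2 + c) * δ) :=
      mul_le_mul_of_nonneg_left hpoly hK
    nlinarith
  have hmart : martBound κ K δ (δ ^ 2) ≤ (Real.sqrt κ * K + κ / 2 * (K + K ^ 2) * 2) * δ := by
    unfold martBound
    have : δ ^ 2 + δ ^ 2 ≤ 2 * δ := by nlinarith
    have hk : 0 ≤ κ / 2 * (K + K ^ 2) := by positivity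
    nlinarith [mul_le_mul_of_nonneg_left this hk]
  unfold bdryTerm bdryC
  rw [hS]
  linarith

/-- `incRunSup ≤ M` if all increments over the cell are `≤ M`. [folklore] -/
theorem incRunSup_le_of_forall {u h : ℝ≥0} {ω : ℝ≥0 → ℝ} {M : ℝ}
    (hM : ∀ v : ℝ≥0, v ≤ h → |brownian (u + v) ω - brownian u ω| ≤ M) : incRunSup u h ω ≤ M :=
  ciSup_le fun p ↦ hM _ (dyadTime_le h p.1 p.2)

/-! ### Splitting the cell polynomial: pure Brownian part and clock part -/

/-- The pure Brownian part of the cell polynomial (handled in expectation):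
`h √κ osc + 4 h√h + h² + 4 √κ³ dB³ + h √κ dB`. [folklore] -/
def pureP (κ osc dB h : ℝ) : ℝ :=
  h * (Real.sqrt κ * osc) + 4 * h * Real.sqrt h + h ^ 2 + 4 * (Real.sqrt κ ^ 3 * dB ^ 3) + h * (Real.sqrt κ * dB)

/-- The clock part of the cell polynomial (handled pathwise; every term carries a factor `dI`):
`h|ρ| dI + 4|ρ|³ dI³ + 4 dI² + 2 dI (√κ dB + |ρ| dI) + 2h dI + h|ρ| dI`. [folklore] -/
def mixedP (κ ρ dB dI h : ℝ) : ℝ :=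
  h * (|ρ| * dI) + 4 * (|ρ| ^ 3 * dI ^ 3) + 4 * dI ^ 2 + 2 * dI * (Real.sqrt κ * dB + |ρ| * dI) + 2 * h * dI + h * (|ρ| * dI)

/-- `0 ≤ pureP`. [folklore] -/
theorem pureP_nonneg {κ osc dB h : ℝ} (ho : 0 ≤ osc) (hdB : 0 ≤ dB) (hh : 0 ≤ h) : 0 ≤ pureP κ osc dB h := by
  unfold pureP; positivity

/-- `0 ≤ mixedP`. [folklore] -/
theorem mixedP_nonneg {κ ρ dB dI h : ℝ} (hdB : 0 ≤ dB) (hdI : 0 ≤ dI) (hh : 0 ≤ h) : 0 ≤ mixedP κ ρ dB dI h := by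
  unfold mixedP; positivity

/-- **`cellPoly ≤ pureP + mixedP`** when `|x| ≤ √κ dB + |ρ| dI`. [folklore] -/
theorem cellPoly_le_pure_add_mixed {κ ρ osc dB dI h X : ℝ} (hdB : 0 ≤ dB) (hdI : 0 ≤ dI) (hh : 0 ≤ h)
    (hX0 : 0 ≤ X) (hX : X ≤ Real.sqrt κ * dB + |ρ| * dI) :
    cellPoly X (2 * dI) h (Real.sqrt κ * osc + |ρ| * dI + 4 * Real.sqrt h) ≤ pureP κ osc dB h + mixedP κ ρ dB dI h := by
  have ha : 0 ≤ Real.sqrt κ * dB := by positivity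
  have hb : 0 ≤ |ρ| * dI := by positivity
  have e1 : X ^ 3 ≤ 4 * (Real.sqrt κ ^ 3 * dB ^ 3) + 4 * (|ρ| ^ 3 * dI ^ 3) := by
    -- `(p + q)³ ≤ 4(p³ + q³)` for `p, q ≥ 0`
    have hcube : ∀ {p q : ℝ}, 0 ≤ p → 0 ≤ q → (p + q) ^ 3 ≤ 4 * (p ^ 3 + q ^ 3) := fun {p q} hp hq ↦ by
      nlinarith [sq_nonneg (p - q), mul_nonneg hp hq, mul_nonneg (mul_nonneg hp hq) (add_nonneg hp hq), sq_nonneg (p + q)]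
    calc X ^ 3 ≤ (Real.sqrt κ * dB + |ρ| * dI) ^ 3 := pow_le_pow_left₀ hX0 hX 3
      _ ≤ 4 * ((Real.sqrt κ * dB) ^ 3 + (|ρ| * dI) ^ 3) := hcube ha hb
      _ = _ := by ring
  have e2 : 2 * dI * X ≤ 2 * dI * (Real.sqrt κ * dB + |ρ| * dI) := by gcongr
  have e3 : h * X ≤ h * (Real.sqrt κ * dB + |ρ| * dI) := by gcongr
  have x1 : h * (Real.sqrt κ * osc + |ρ| * dI + 4 * Real.sqrt h) = h * (Real.sqrt κ * osc) + h * (|ρ| * dI) + 4 * h * Real.sqrt h := by ring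
  have x2 : (2 * dI) ^ 2 = 4 * dI ^ 2 := by ring
  have x3 : h * (2 * dI) = 2 * h * dI := by ring
  have x4 : h * (Real.sqrt κ * dB + |ρ| * dI) = h * (Real.sqrt κ * dB) + h * (|ρ| * dI) := by ring
  unfold cellPoly pureP mixedP
  rw [x1, x2, x3]
  linarith

/-! ### The expectation part of the cell bound -/

/-- The expectation part of the bound of one cell: the crude bound on the large-oscillation event
plus `K pureP`. [folklore] -/
def Ecell (κ K c₁ : ℝ) (u h : ℝ≥0) (ω : ℝ≥0 → ℝ) : ℝ :=
  {ω | c₁ ≤ incRunSup u h ω}.indicator (fun ω ↦ 1 + martBound κ K |brownian (u + h) ω - brownian u ω| h) ω +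
    K * pureP κ (incRunSup u h ω) |brownian (u + h) ω - brownian u ω| h

/-- The rate `E[Ecell] ≤ h · erate h` with `erate h → 0`. [folklore] -/
def erate (κ K c₁ h : ℝ) : ℝ :=
  128 * h / c₁ ^ 4 + Real.sqrt κ * K * (32 * Real.sqrt h) / c₁ ^ 2 + κ / 2 * (K + K ^ 2) * (20 * h / c₁ ^ 2 + 128 * h ^ 2 / c₁ ^ 4) +
    K * (2 * Real.sqrt κ * Real.sqrt h + 4 * Real.sqrt h + h + 4 * Real.sqrt 3 * Real.sqrt κ ^ 3 * Real.sqrt h + Real.sqrt κ * Real.sqrt h)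

/-- `erate h → 0` as `h → 0⁺`. [folklore] -/
theorem tendsto_erate (κ K c₁ : ℝ) : Tendsto (fun h ↦ erate κ K c₁ h) (𝓝[≥] 0) (𝓝 0) := by
  have hc : ContinuousWithinAt (fun h ↦ erate κ K c₁ h) (Ici 0) 0 := by
    unfold erate
    fun_prop
  have h0 : erate κ K c₁ 0 = 0 := by simp [erate]
  simpa [h0] using hc.tendsto

/-- `Ecell` is measurable. [folklore] -/
theorem measurable_Ecell (κ K c₁ : ℝ) (u h : ℝ≥0) : Measurable (Ecell κ K c₁ u h) := by
  have hosc := measurable_incRunSup' u h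
  have hΔB : Measurable fun ω ↦ |brownian (u + h) ω - brownian u ω| :=
    ((measurable_brownian _).sub (measurable_brownian _)).abs
  unfold Ecell martBound pureP
  refine Measurable.add (Measurable.indicator ?_ (measurableSet_incRunSup_ge u h c₁)) ?_
  · fun_prop
  · fun_prop

/-- `0 ≤ Ecell`. [folklore] -/
theorem Ecell_nonneg {κ K c₁ : ℝ} (hκ : 0 ≤ κ) (hK : 0 ≤ K) (u h : ℝ≥0) (ω : ℝ≥0 → ℝ) : 0 ≤ Ecell κ K c₁ u h ω := by
  have h1 : 0 ≤ {ω | c₁ ≤ incRunSup u h ω}.indicator (fun ω ↦ 1 + martBound κ K |brownian (u + h) ω - brownian u ω| h) ω := by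
    refine Set.indicator_nonneg (fun ω' _ ↦ ?_) ω
    have := martBound_nonneg hκ hK (abs_nonneg (brownian (u + h) ω' - brownian u ω')) h.coe_nonneg
    linarith
  have h2 := pureP_nonneg (κ := κ) (incRunSup_nonneg u h ω) (abs_nonneg (brownian (u + h) ω - brownian u ω)) h.coe_nonneg
  unfold Ecell; positivity

/-- **`E[Ecell] ≤ h · erate h`** for `h ≤ c₁²/8` (the `O(h²)` tail of the oscillation, Cauchy–Schwarz,
and the Brownian moments). [cite: RevuzYor1999, Ch. II Thm (1.7)] -/
theorem integral_Ecell_le {κ K c₁ : ℝ} (hκ : 0 ≤ κ) (hK : 0 ≤ K) (hc₁ : 0 < c₁) (u h : ℝ≥0) (hh : (h : ℝ) ≤ c₁ ^ 2 / 8) :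
    Integrable (Ecell κ K c₁ u h) preWienerMeasure ∧
      ∫ ω, Ecell κ K c₁ u h ω ∂preWienerMeasure ≤ (h : ℝ) * erate κ K c₁ h := by
  haveI := isProbabilityMeasure_preWienerMeasure'
  set A := {ω : ℝ≥0 → ℝ | c₁ ≤ incRunSup u h ω} with hA
  have hAm : MeasurableSet A := measurableSet_incRunSup_ge u h c₁
  set ΔB : (ℝ≥0 → ℝ) → ℝ := fun ω ↦ brownian (u + h) ω - brownian u ω with hΔB
  have hΔBm : Measurable ΔB := (measurable_brownian _).sub (measurable_brownian _)
  have hh0 : (0 : ℝ) ≤ h := h.coe_nonneg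
  -- integrability of the moments
  have hosc_i := integrable_incRunSup u h
  have hΔB1 : Integrable (fun ω ↦ |ΔB ω|) preWienerMeasure :=
    ((memLp_two_brownian_sub u (u + h)).integrable one_le_two).abs
  have hΔB2 : Integrable (fun ω ↦ ΔB ω ^ 2) preWienerMeasure := (memLp_two_brownian_sub u (u + h)).integrable_sq
  have hΔB3 : Integrable (fun ω ↦ |ΔB ω| ^ 3) preWienerMeasure := by
    have := (memLp_brownian_sub u (u + h) (p := 3) (by norm_num)).integrable_norm_pow (by norm_num)
    refine this.congr (ae_of_all _ fun ω ↦ ?_)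
    simp [hΔB, Real.norm_eq_abs]
  -- the moments
  have hle_uh : u ≤ u + h := le_self_add
  have hsub : ((u + h : ℝ≥0) : ℝ) - u = h := by push_cast; ring
  obtain ⟨hm1, hm3⟩ := integral_abs_brownian_sub_moments hle_uh
  rw [hsub] at hm1 hm3
  have hmosc := integral_incRunSup_le u h
  have hPA := measureReal_incRunSup_ge_le' u h hc₁ hh
  have hIosc := setIntegral_incRunSup_bad_le u h hc₁ hh
  have hIsq := setIntegral_sq_incr_bad_le u h hc₁ hh
  -- the indicator part
  set f : (ℝ≥0 → ℝ) → ℝ := fun ω ↦ 1 + martBound κ K |ΔB ω| h with hf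
  set a : (ℝ≥0 → ℝ) → ℝ := fun ω ↦ Real.sqrt κ * K * |ΔB ω| with ha
  set b : (ℝ≥0 → ℝ) → ℝ := fun ω ↦ κ / 2 * (K + K ^ 2) * (ΔB ω ^ 2 + h) with hb
  have hf_eq : ∀ ω, f ω = (1 + a ω) + b ω := fun ω ↦ by simp only [hf, ha, hb, martBound, sq_abs]; ring
  have hai : Integrable a preWienerMeasure := hΔB1.const_mul _
  have hbi : Integrable b preWienerMeasure := (hΔB2.add (integrable_const _)).const_mul _
  have h1ai : Integrable (fun ω ↦ (1 : ℝ) + a ω) preWienerMeasure := (integrable_const _).add hai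
  have hfi : Integrable f preWienerMeasure := (h1ai.add hbi).congr (ae_of_all _ fun ω ↦ (hf_eq ω).symm)
  have hind_i : Integrable (A.indicator f) preWienerMeasure := hfi.indicator hAm
  have hPA0 : 0 ≤ preWienerMeasure.real A := measureReal_nonneg
  have hA1 : ∫ ω in A, |ΔB ω| ∂preWienerMeasure ≤ 32 * ((h : ℝ) * Real.sqrt h) / c₁ ^ 2 := by
    refine le_trans (setIntegral_mono_on hΔB1.integrableOn hosc_i.integrableOn hAm fun ω _ ↦ ?_) hIosc
    exact abs_incr_le_incRunSup le_rfl ω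
  have hA2 : ∫ ω in A, ΔB ω ^ 2 ∂preWienerMeasure ≤ 20 * (h : ℝ) ^ 2 / c₁ ^ 2 := hIsq
  have hinta : ∫ ω in A, a ω ∂preWienerMeasure ≤ Real.sqrt κ * K * (32 * ((h : ℝ) * Real.sqrt h) / c₁ ^ 2) := by
    simp only [ha]
    rw [integral_const_mul]
    exact mul_le_mul_of_nonneg_left hA1 (by positivity)
  have hintb : ∫ ω in A, b ω ∂preWienerMeasure ≤ κ / 2 * (K + K ^ 2) * (20 * (h : ℝ) ^ 2 / c₁ ^ 2 + 128 * (h : ℝ) ^ 2 / c₁ ^ 4 * h) := by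
    simp only [hb]
    rw [integral_const_mul, integral_add hΔB2.integrableOn (integrable_const _).integrableOn, setIntegral_const, smul_eq_mul]
    refine mul_le_mul_of_nonneg_left (add_le_add hA2 ?_) (by positivity)
    exact mul_le_mul_of_nonneg_right hPA hh0
  have hind : ∫ ω, A.indicator f ω ∂preWienerMeasure ≤
      128 * (h : ℝ) ^ 2 / c₁ ^ 4 + Real.sqrt κ * K * (32 * ((h : ℝ) * Real.sqrt h) / c₁ ^ 2) +
        κ / 2 * (K + K ^ 2) * (20 * (h : ℝ) ^ 2 / c₁ ^ 2 + 128 * (h : ℝ) ^ 2 / c₁ ^ 4 * h) := by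
    rw [integral_indicator hAm, integral_congr_ae (ae_of_all _ fun ω ↦ hf_eq ω)]
    · rw [integral_add h1ai.integrableOn hbi.integrableOn, integral_add (integrable_const _).integrableOn hai.integrableOn,
        setIntegral_const, smul_eq_mul, mul_one]
      linarith
  -- the pure part
  set p : (ℝ≥0 → ℝ) → ℝ := fun ω ↦ K * pureP κ (incRunSup u h ω) |ΔB ω| h with hp
  set q1 : (ℝ≥0 → ℝ) → ℝ := fun ω ↦ (h : ℝ) * Real.sqrt κ * incRunSup u h ω with hq1
  set q4 : (ℝ≥0 → ℝ) → ℝ := fun ω ↦ 4 * Real.sqrt κ ^ 3 * |ΔB ω| ^ 3 with hq4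
  set q5 : (ℝ≥0 → ℝ) → ℝ := fun ω ↦ (h : ℝ) * Real.sqrt κ * |ΔB ω| with hq5
  have hp_eq : ∀ ω, p ω = K * (((q1 ω + (4 * h * Real.sqrt h + (h : ℝ) ^ 2)) + q4 ω) + q5 ω) := fun ω ↦ by
    simp only [hp, hq1, hq4, hq5, pureP]; ring
  have hq1i : Integrable q1 preWienerMeasure := hosc_i.const_mul _
  have hq4i : Integrable q4 preWienerMeasure := hΔB3.const_mul _
  have hq5i : Integrable q5 preWienerMeasure := hΔB1.const_mul _
  have hqi : Integrable (fun ω ↦ ((q1 ω + (4 * h * Real.sqrt h + (h : ℝ) ^ 2)) + q4 ω) + q5 ω) preWienerMeasure :=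
    ((hq1i.add (integrable_const _)).add hq4i).add hq5i
  have hpure_i : Integrable p preWienerMeasure := (hqi.const_mul K).congr (ae_of_all _ fun ω ↦ (hp_eq ω).symm)
  have hq1b : ∫ ω, q1 ω ∂preWienerMeasure ≤ (h : ℝ) * Real.sqrt κ * (2 * Real.sqrt h) := by
    simp only [hq1]; rw [integral_const_mul]; exact mul_le_mul_of_nonneg_left hmosc (by positivity)
  have hq4b : ∫ ω, q4 ω ∂preWienerMeasure ≤ 4 * Real.sqrt κ ^ 3 * (Real.sqrt 3 * ((h : ℝ) * Real.sqrt h)) := by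
    simp only [hq4]; rw [integral_const_mul]; exact mul_le_mul_of_nonneg_left hm3 (by positivity)
  have hq5b : ∫ ω, q5 ω ∂preWienerMeasure ≤ (h : ℝ) * Real.sqrt κ * Real.sqrt h := by
    simp only [hq5]; rw [integral_const_mul]; exact mul_le_mul_of_nonneg_left hm1 (by positivity)
  have hpure : ∫ ω, p ω ∂preWienerMeasure ≤
      K * (((h : ℝ) * Real.sqrt κ * (2 * Real.sqrt h) + (4 * h * Real.sqrt h + (h : ℝ) ^ 2)) +
        4 * Real.sqrt κ ^ 3 * (Real.sqrt 3 * ((h : ℝ) * Real.sqrt h)) + (h : ℝ) * Real.sqrt κ * Real.sqrt h) := by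
    rw [integral_congr_ae (ae_of_all _ fun ω ↦ hp_eq ω), integral_const_mul]
    refine mul_le_mul_of_nonneg_left ?_ hK
    have i12 : Integrable (fun ω ↦ q1 ω + (4 * h * Real.sqrt h + (h : ℝ) ^ 2)) preWienerMeasure := hq1i.add (integrable_const _)
    have i124 : Integrable (fun ω ↦ q1 ω + (4 * h * Real.sqrt h + (h : ℝ) ^ 2) + q4 ω) preWienerMeasure := i12.add hq4i
    have ic : Integrable (fun _ : ℝ≥0 → ℝ ↦ (4 * h * Real.sqrt h + (h : ℝ) ^ 2)) preWienerMeasure := integrable_const _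
    rw [integral_add i124 hq5i, integral_add i12 hq4i, integral_add hq1i ic, integral_const, smul_eq_mul, probReal_univ, one_mul]
    linarith
  refine ⟨hind_i.add hpure_i, ?_⟩
  have e : Ecell κ K c₁ u h = fun ω ↦ A.indicator f ω + p ω := rfl
  rw [e, integral_add hind_i hpure_i]
  have hfinal : 128 * (h : ℝ) ^ 2 / c₁ ^ 4 + Real.sqrt κ * K * (32 * ((h : ℝ) * Real.sqrt h) / c₁ ^ 2) +
        κ / 2 * (K + K ^ 2) * (20 * (h : ℝ) ^ 2 / c₁ ^ 2 + 128 * (h : ℝ) ^ 2 / c₁ ^ 4 * h) +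
      K * (((h : ℝ) * Real.sqrt κ * (2 * Real.sqrt h) + (4 * h * Real.sqrt h + (h : ℝ) ^ 2)) +
        4 * Real.sqrt κ ^ 3 * (Real.sqrt 3 * ((h : ℝ) * Real.sqrt h)) + (h : ℝ) * Real.sqrt κ * Real.sqrt h) =
      (h : ℝ) * erate κ K c₁ h := by
    unfold erate; ring
  linarith

/-! ### The pathwise part of the cell bound -/

namespace CellScheme

variable {κ ρ K c₀ : ℝ} {Tmax : ℝ≥0} {Y I W J : ℝ≥0 → (ℝ≥0 → ℝ) → ℝ} {ℓ₁ m₁ ℓ₂ lam : ℝ≥0 → (ℝ≥0 → ℝ) → ℂ}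
  {τ : (ℝ≥0 → ℝ) → WithTop ℝ≥0} (h𝒮 : CellScheme κ ρ K c₀ Tmax Y I W J ℓ₁ m₁ ℓ₂ lam τ)

/-- The pathwise part of the bound of the cell `[u, u + hh]`: the cells of large clock increment,
the boundary cell, and the clock/drift/cross terms of the interior cells. [folklore] -/
def Pcell (κ ρ K : ℝ) (τ : (ℝ≥0 → ℝ) → WithTop ℝ≥0) (I W : ℝ≥0 → (ℝ≥0 → ℝ) → ℝ) (c₁ θ : ℝ) (u hh : ℝ≥0) (ω : ℝ≥0 → ℝ) : ℝ :=
  (if ((u : ℝ≥0) : WithTop ℝ≥0) < τ ω ∧ incRunSup u hh ω < c₁ ∧ θ < I (u + hh) ω - I u ω then 1 + martBound κ K c₁ hh else 0) +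
  (if ((u : ℝ≥0) : WithTop ℝ≥0) < τ ω ∧ incRunSup u hh ω < c₁ ∧ I (u + hh) ω - I u ω ≤ θ ∧ τ ω < ((u + hh : ℝ≥0) : WithTop ℝ≥0) then
      bdryTerm κ ρ K (incRunSup u hh ω) (I (u + hh) ω - I u ω) hh else 0) +
  (if ((u : ℝ≥0) : WithTop ℝ≥0) < τ ω ∧ incRunSup u hh ω < c₁ ∧ I (u + hh) ω - I u ω ≤ θ ∧ ((u + hh : ℝ≥0) : WithTop ℝ≥0) ≤ τ ω then
      K * mixedP κ ρ |brownian (u + hh) ω - brownian u ω| (I (u + hh) ω - I u ω) hh +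
        (K + κ / 2 * (K + K ^ 2)) * |(hh : ℝ) - (W u ω + 2 * I u ω) * (I (u + hh) ω - I u ω)| +
        2⁻¹ * (K + K ^ 2) * (2 * Real.sqrt κ * |ρ| * |brownian (u + hh) ω - brownian u ω| * (I (u + hh) ω - I u ω) +
          ρ ^ 2 * (I (u + hh) ω - I u ω) ^ 2) else 0)

include h𝒮 in
/-- `0 ≤ Pcell`. [folklore] -/
theorem Pcell_nonneg (c₁ θ : ℝ) (hc₁ : 0 < c₁) (u hh : ℝ≥0) (ω : ℝ≥0 → ℝ) : 0 ≤ Pcell κ ρ K τ I W c₁ θ u hh ω := by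
  have hκ := h𝒮.κ_pos.le
  have hK := h𝒮.K_pos.le
  have hΔI : 0 ≤ I (u + hh) ω - I u ω := sub_nonneg.2 (h𝒮.monotone_I ω le_self_add)
  have hh0 : (0 : ℝ) ≤ hh := hh.coe_nonneg
  unfold Pcell
  refine add_nonneg (add_nonneg ?_ ?_) ?_
  · split_ifs
    · have := martBound_nonneg hκ hK hc₁.le hh0; linarith
    · exact le_rfl
  · split_ifs
    · exact bdryTerm_nonneg hκ hK (incRunSup_nonneg u hh ω) hΔI hh0
    · exact le_rfl
  · split_ifs
    · have := mixedP_nonneg (κ := κ) (ρ := ρ) (abs_nonneg (brownian (u + hh) ω - brownian u ω)) hΔI hh0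
      positivity
    · exact le_rfl

include h𝒮 in
/-- `Pcell` is measurable. [folklore] -/
theorem measurable_Pcell (c₁ θ : ℝ) (u hh : ℝ≥0) : Measurable (Pcell κ ρ K τ I W c₁ θ u hh) := by
  have hτ := h𝒮.isStoppingTime
  have m1 : MeasurableSet {ω : ℝ≥0 → ℝ | ((u : ℝ≥0) : WithTop ℝ≥0) < τ ω} := brownianFiltration.le u _ (hτ.measurableSet_gt u)
  have m2 : MeasurableSet {ω : ℝ≥0 → ℝ | τ ω < ((u + hh : ℝ≥0) : WithTop ℝ≥0)} :=
    brownianFiltration.le (u + hh) _ (hτ.measurableSet_lt (u + hh))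
  have m3 : MeasurableSet {ω : ℝ≥0 → ℝ | ((u + hh : ℝ≥0) : WithTop ℝ≥0) ≤ τ ω} :=
    brownianFiltration.le (u + hh) _ (hτ.measurableSet_ge (u + hh))
  have hosc := measurable_incRunSup' u hh
  have hI : ∀ r, Measurable (I r) := fun r ↦ (h𝒮.adapted_I r).mono (brownianFiltration.le r) le_rfl
  have hW : ∀ r, Measurable (W r) := fun r ↦ (h𝒮.adapted_W r).mono (brownianFiltration.le r) le_rfl
  have hΔI : Measurable fun ω ↦ I (u + hh) ω - I u ω := (hI _).sub (hI _)
  have hΔB : Measurable fun ω ↦ |brownian (u + hh) ω - brownian u ω| := ((measurable_brownian _).sub (measurable_brownian _)).abs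
  have mosc : MeasurableSet {ω : ℝ≥0 → ℝ | incRunSup u hh ω < c₁} := measurableSet_lt hosc measurable_const
  have mθ : MeasurableSet {ω : ℝ≥0 → ℝ | θ < I (u + hh) ω - I u ω} := measurableSet_lt measurable_const hΔI
  have mθ' : MeasurableSet {ω : ℝ≥0 → ℝ | I (u + hh) ω - I u ω ≤ θ} := measurableSet_le hΔI measurable_const
  unfold Pcell
  refine Measurable.add (Measurable.add ?_ ?_) ?_
  · refine Measurable.ite (m1.inter (mosc.inter mθ)) measurable_const measurable_const
  · refine Measurable.ite (m1.inter (mosc.inter (mθ'.inter m2))) ?_ measurable_const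
    unfold bdryTerm stepBound martBound cellPoly
    fun_prop
  · refine Measurable.ite (m1.inter (mosc.inter (mθ'.inter m3))) ?_ measurable_const
    unfold mixedP
    fun_prop

include h𝒮 in
/-- **The cell bound splits into expectation part and pathwise part**: on a sample with
`W = √κ B + ρ I`, the four-term bound of `norm_cell_sub_martPart_le` is `≤ Ecell + Pcell`
(`cellPoly ≤ pureP + mixedP` with `x = √κ ΔB + ρ ΔI`). [folklore] -/
theorem cellBound_le_Ecell_add_Pcell {ω : ℝ≥0 → ℝ} (hω : ∀ t, W t ω = Real.sqrt κ * brownian t ω + ρ * I t ω)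
    {c₁ θ : ℝ} (u hh : ℝ≥0) :
    (if c₁ ≤ incRunSup u hh ω then 1 + martBound κ K |brownian (u + hh) ω - brownian u ω| hh else 0) +
      (if ((u : ℝ≥0) : WithTop ℝ≥0) < τ ω ∧ incRunSup u hh ω < c₁ ∧ θ < I (u + hh) ω - I u ω then 1 + martBound κ K c₁ hh else 0) +
      (if ((u : ℝ≥0) : WithTop ℝ≥0) < τ ω ∧ incRunSup u hh ω < c₁ ∧ I (u + hh) ω - I u ω ≤ θ ∧ τ ω < ((u + hh : ℝ≥0) : WithTop ℝ≥0) then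
          bdryTerm κ ρ K (incRunSup u hh ω) (I (u + hh) ω - I u ω) hh else 0) +
      (if ((u : ℝ≥0) : WithTop ℝ≥0) < τ ω ∧ incRunSup u hh ω < c₁ ∧ I (u + hh) ω - I u ω ≤ θ ∧ ((u + hh : ℝ≥0) : WithTop ℝ≥0) ≤ τ ω then
          intTerm κ ρ K (incRunSup u hh ω) |brownian (u + hh) ω - brownian u ω| (I (u + hh) ω - I u ω)
            (W (u + hh) ω - W u ω) (W u ω + 2 * I u ω) hh else 0) ≤
      Ecell κ K c₁ u hh ω + Pcell κ ρ K τ I W c₁ θ u hh ω := by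
  have hK := h𝒮.K_pos.le
  set ΔB := brownian (u + hh) ω - brownian u ω with hΔB
  set ΔI := I (u + hh) ω - I u ω with hΔI
  have hΔI0 : 0 ≤ ΔI := sub_nonneg.2 (h𝒮.monotone_I ω le_self_add)
  have hh0 : (0 : ℝ) ≤ hh := hh.coe_nonneg
  have hx : W (u + hh) ω - W u ω = Real.sqrt κ * ΔB + ρ * ΔI := by rw [hω, hω, hΔB, hΔI]; ring
  have hxle : |W (u + hh) ω - W u ω| ≤ Real.sqrt κ * |ΔB| + |ρ| * ΔI := by
    rw [hx]
    calc |Real.sqrt κ * ΔB + ρ * ΔI| ≤ |Real.sqrt κ * ΔB| + |ρ * ΔI| := abs_add_le _ _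
      _ = Real.sqrt κ * |ΔB| + |ρ| * ΔI := by rw [abs_mul, abs_mul, abs_of_nonneg (Real.sqrt_nonneg κ), abs_of_nonneg hΔI0]
  have hpoly := cellPoly_le_pure_add_mixed (κ := κ) (ρ := ρ) (osc := incRunSup u hh ω) (abs_nonneg ΔB) hΔI0 hh0 (abs_nonneg _) hxle
  have hpure0 := pureP_nonneg (κ := κ) (incRunSup_nonneg u hh ω) (abs_nonneg ΔB) hh0
  -- the indicator forms agree
  have hT1 : (if c₁ ≤ incRunSup u hh ω then 1 + martBound κ K |ΔB| hh else 0) =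
      {ω | c₁ ≤ incRunSup u hh ω}.indicator (fun ω ↦ 1 + martBound κ K |brownian (u + hh) ω - brownian u ω| hh) ω := by
    by_cases hc : c₁ ≤ incRunSup u hh ω
    · rw [if_pos hc, Set.indicator_of_mem (show ω ∈ {ω | c₁ ≤ incRunSup u hh ω} from hc)]
    · rw [if_neg hc, Set.indicator_of_notMem (show ω ∉ {ω | c₁ ≤ incRunSup u hh ω} from hc)]
  have hT4 : (if ((u : ℝ≥0) : WithTop ℝ≥0) < τ ω ∧ incRunSup u hh ω < c₁ ∧ ΔI ≤ θ ∧ ((u + hh : ℝ≥0) : WithTop ℝ≥0) ≤ τ ω then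
        intTerm κ ρ K (incRunSup u hh ω) |ΔB| ΔI (W (u + hh) ω - W u ω) (W u ω + 2 * I u ω) hh else 0) ≤
      K * pureP κ (incRunSup u hh ω) |ΔB| hh +
      (if ((u : ℝ≥0) : WithTop ℝ≥0) < τ ω ∧ incRunSup u hh ω < c₁ ∧ ΔI ≤ θ ∧ ((u + hh : ℝ≥0) : WithTop ℝ≥0) ≤ τ ω then
        K * mixedP κ ρ |ΔB| ΔI hh + (K + κ / 2 * (K + K ^ 2)) * |(hh : ℝ) - (W u ω + 2 * I u ω) * ΔI| +
          2⁻¹ * (K + K ^ 2) * (2 * Real.sqrt κ * |ρ| * |ΔB| * ΔI + ρ ^ 2 * ΔI ^ 2) else 0) := by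
    split_ifs
    · unfold intTerm
      have := mul_le_mul_of_nonneg_left hpoly hK
      nlinarith
    · have := mul_nonneg hK hpure0; linarith
  unfold Ecell Pcell
  rw [← hT1]
  linarith

include h𝒮 in
/-- `I_t ≤ K` up to and including the stopping time. [folklore] -/
theorem I_le_of_le {t : ℝ≥0} {ω : ℝ≥0 → ℝ} (ht : ((t : ℝ≥0) : WithTop ℝ≥0) ≤ τ ω) : I t ω ≤ K :=
  (h𝒮.bound t ω ht).2.2.2.2.1

/-! ### Sums over a partition: the pathwise part is uniformly bounded and tends to zero -/

section Sums

variable {s t : ℝ≥0}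

/-- At most one cell straddles a given time. [folklore] -/
theorem sum_ite_straddle_le (s t T : ℝ≥0) (n : ℕ) {c : ℝ} (hc : 0 ≤ c) :
    ∑ i ∈ Finset.range n, (if grid s t n i < T ∧ T < grid s t n (i + 1) then c else 0) ≤ c := by
  classical
  rw [← Finset.sum_filter]
  have hcard : ((Finset.range n).filter fun i ↦ grid s t n i < T ∧ T < grid s t n (i + 1)).card ≤ 1 := by
    refine Finset.card_le_one.2 fun i hi j hj ↦ ?_
    rw [Finset.mem_filter] at hi hj
    by_contra hij
    rcases lt_or_gt_of_ne hij with h | h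
    · have := grid_monotone s t n (Nat.succ_le_of_lt h)
      exact absurd (hi.2.2.trans_le (this.trans hj.2.1.le)) (lt_irrefl _)
    · have := grid_monotone s t n (Nat.succ_le_of_lt h)
      exact absurd (hj.2.2.trans_le (this.trans hi.2.1.le)) (lt_irrefl _)
  rw [Finset.sum_const, nsmul_eq_mul]
  calc _ ≤ (1 : ℝ) * c := by gcongr; exact_mod_cast hcard
    _ = c := one_mul c

include h𝒮 in
/-- **The (weighted) clock increments of the cells ending before `τ` sum to at most `K`.** [folklore] -/
theorem sum_ite_mul_sub_le (n : ℕ) (ω : ℝ≥0 → ℝ) {w : ℕ → ℝ} (hw1 : ∀ i, w i ≤ 1) :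
    ∑ i ∈ Finset.range n,
      (if ((grid s t n (i + 1) : ℝ≥0) : WithTop ℝ≥0) ≤ τ ω then w i * (I (grid s t n (i + 1)) ω - I (grid s t n i) ω) else 0) ≤ K := by
  classical
  obtain ⟨m, hmN, hm⟩ := exists_initial_segment s t (h𝒮.τr ω) n
  have hτ := h𝒮.τ_eq ω
  have hK := h𝒮.K_pos.le
  have hincr : ∀ i, 0 ≤ I (grid s t n (i + 1)) ω - I (grid s t n i) ω := fun i ↦
    sub_nonneg.2 (h𝒮.monotone_I ω (grid_monotone s t n (Nat.le_succ i)))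
  have hle : ∀ i ∈ Finset.range n,
      (if ((grid s t n (i + 1) : ℝ≥0) : WithTop ℝ≥0) ≤ τ ω then w i * (I (grid s t n (i + 1)) ω - I (grid s t n i) ω) else 0) ≤
        if i < m then I (grid s t n (i + 1)) ω - I (grid s t n i) ω else 0 := by
    intro i hi
    rw [Finset.mem_range] at hi
    split_ifs with h1 h2 h2
    · exact mul_le_of_le_one_left (hincr i) (hw1 i)
    · exact absurd ((hm i hi).1 (by rw [hτ] at h1; exact_mod_cast h1)) h2
    · exact hincr i
    · exact le_rfl
  refine (Finset.sum_le_sum hle).trans ?_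
  rw [← Finset.sum_filter]
  have hfilter : (Finset.range n).filter (fun i ↦ i < m) = Finset.range m := by
    ext i; simp only [Finset.mem_filter, Finset.mem_range]; omega
  rw [hfilter, Finset.sum_range_sub (fun i ↦ I (grid s t n i) ω), grid_zero]
  rcases m.eq_zero_or_pos with h0 | hpos
  · subst h0; rw [grid_zero, sub_self]; exact hK
  · obtain ⟨k, rfl⟩ := Nat.exists_eq_succ_of_ne_zero hpos.ne'
    have hgm : I (grid s t n (k + 1)) ω ≤ K :=
      h𝒮.I_le_of_le (by rw [hτ]; exact_mod_cast (hm k (by omega)).2 (Nat.lt_succ_self k))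
    linarith [h𝒮.I_nonneg s ω]

/-! #### The constants -/

omit h𝒮 in
/-- `C_H = K + (κ/2)(K + K²)`, the bound of `H = λ + (κ/2)(ℓ₂ + ℓ₁²)`. [folklore] -/
def CH (κ K : ℝ) : ℝ := K + κ / 2 * (K + K ^ 2)

omit h𝒮 in
/-- `M₁`: `mixedP ≤ ΔI · M₁` on a controlled interior cell (`|ΔB| ≤ c₁`, `ΔI ≤ θ`, `h ≤ 1`). [folklore] -/
def M₁ (κ ρ c₁ θ : ℝ) : ℝ := |ρ| + 4 * |ρ| ^ 3 * θ ^ 2 + 4 * θ + 2 * (Real.sqrt κ * c₁ + |ρ| * θ) + 2 + |ρ|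

omit h𝒮 in
/-- `M_tot`: the interior term is `≤ ΔI · M_tot + C_H h` on a controlled interior cell. [folklore] -/
def Mtot (κ ρ K c₁ θ : ℝ) : ℝ := K * M₁ κ ρ c₁ θ + CH κ K * K + 2⁻¹ * (K + K ^ 2) * (2 * Real.sqrt κ * |ρ| * c₁ + ρ ^ 2 * θ)

omit h𝒮 in
/-- `M_lin`: the interior term is `≤ ΔI · δ · M_lin` on a `δ`-small interior cell. [folklore] -/
def Mlin (κ ρ K : ℝ) : ℝ :=
  K * (|ρ| + 4 * |ρ| ^ 3 + 4 + 2 * (Real.sqrt κ + |ρ|) + 2 + |ρ|) + CH κ K + 2⁻¹ * (K + K ^ 2) * (2 * Real.sqrt κ * |ρ| + ρ ^ 2)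

omit h𝒮 in
/-- The uniform bound of the pathwise sums over a partition of an interval of length `L`. [folklore] -/
def Pconst (κ ρ K c₁ θ L : ℝ) : ℝ :=
  (K / θ + 1) * (1 + martBound κ K c₁ 1) + bdryTerm κ ρ K c₁ θ 1 + Mtot κ ρ K c₁ θ * K + CH κ K * L

/-! #### The uniform bound on one cell -/

include h𝒮 in
/-- **Uniform bound of the pathwise part of one cell** (`h ≤ 1`). [folklore] -/
theorem Pcell_le_unif {c₁ θ : ℝ} (hc₁ : 0 < c₁) (hθ : 0 < θ) {u hh : ℝ≥0} (hh1 : (hh : ℝ) ≤ 1) (ω : ℝ≥0 → ℝ) :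
    Pcell κ ρ K τ I W c₁ θ u hh ω ≤
      (if ((u : ℝ≥0) : WithTop ℝ≥0) < τ ω ∧ θ < I (u + hh) ω - I u ω then 1 + martBound κ K c₁ 1 else 0) +
      (if ((u : ℝ≥0) : WithTop ℝ≥0) < τ ω ∧ τ ω < ((u + hh : ℝ≥0) : WithTop ℝ≥0) then bdryTerm κ ρ K c₁ θ 1 else 0) +
      (if ((u + hh : ℝ≥0) : WithTop ℝ≥0) ≤ τ ω then 1 * (I (u + hh) ω - I u ω) * Mtot κ ρ K c₁ θ else 0) + CH κ K * hh := by
  have hκ := h𝒮.κ_pos.le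
  have hK := h𝒮.K_pos.le
  set osc := incRunSup u hh ω with hosc
  set ΔB := brownian (u + hh) ω - brownian u ω with hΔB
  set ΔI := I (u + hh) ω - I u ω with hΔI
  have hΔI0 : 0 ≤ ΔI := sub_nonneg.2 (h𝒮.monotone_I ω le_self_add)
  have hh0 : (0 : ℝ) ≤ hh := hh.coe_nonneg
  have hosc0 : 0 ≤ osc := incRunSup_nonneg u hh ω
  have hΔBosc : |ΔB| ≤ osc := abs_incr_le_incRunSup le_rfl ω
  have hmB1 : 0 ≤ 1 + martBound κ K c₁ 1 := by have := martBound_nonneg hκ hK hc₁.le zero_le_one; linarith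
  have hbd1 : 0 ≤ bdryTerm κ ρ K c₁ θ 1 := bdryTerm_nonneg hκ hK hc₁.le hθ.le zero_le_one
  have hCH : 0 ≤ CH κ K := by unfold CH; positivity
  have hMtot : 0 ≤ Mtot κ ρ K c₁ θ := by unfold Mtot M₁ CH; positivity
  have hA : (if ((u : ℝ≥0) : WithTop ℝ≥0) < τ ω ∧ osc < c₁ ∧ θ < ΔI then 1 + martBound κ K c₁ hh else 0) ≤
      (if ((u : ℝ≥0) : WithTop ℝ≥0) < τ ω ∧ θ < ΔI then 1 + martBound κ K c₁ 1 else 0) := by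
    split_ifs with h1 h2 h2
    · have hm : martBound κ K c₁ hh ≤ martBound κ K c₁ 1 := by unfold martBound; gcongr
      linarith
    · exact absurd ⟨h1.1, h1.2.2⟩ h2
    · exact hmB1
    · exact le_rfl
  have hB : (if ((u : ℝ≥0) : WithTop ℝ≥0) < τ ω ∧ osc < c₁ ∧ ΔI ≤ θ ∧ τ ω < ((u + hh : ℝ≥0) : WithTop ℝ≥0) then
        bdryTerm κ ρ K osc ΔI hh else 0) ≤
      (if ((u : ℝ≥0) : WithTop ℝ≥0) < τ ω ∧ τ ω < ((u + hh : ℝ≥0) : WithTop ℝ≥0) then bdryTerm κ ρ K c₁ θ 1 else 0) := by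
    split_ifs with h1 h2 h2
    · exact bdryTerm_mono hκ hK hosc0 hΔI0 hh0 h1.2.1.le h1.2.2.1 hh1
    · exact absurd ⟨h1.1, h1.2.2.2⟩ h2
    · exact hbd1
    · exact le_rfl
  have hC : (if ((u : ℝ≥0) : WithTop ℝ≥0) < τ ω ∧ osc < c₁ ∧ ΔI ≤ θ ∧ ((u + hh : ℝ≥0) : WithTop ℝ≥0) ≤ τ ω then
        K * mixedP κ ρ |ΔB| ΔI hh + (K + κ / 2 * (K + K ^ 2)) * |(hh : ℝ) - (W u ω + 2 * I u ω) * ΔI| +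
          2⁻¹ * (K + K ^ 2) * (2 * Real.sqrt κ * |ρ| * |ΔB| * ΔI + ρ ^ 2 * ΔI ^ 2) else 0) ≤
      (if ((u + hh : ℝ≥0) : WithTop ℝ≥0) ≤ τ ω then 1 * ΔI * Mtot κ ρ K c₁ θ else 0) + CH κ K * hh := by
    split_ifs with h1 h2 h2
    · obtain ⟨-, -, -, -, -, hZK⟩ := h𝒮.bound u ω h1.1.le
      have hΔIθ : ΔI ≤ θ := h1.2.2.1
      have hΔBc : |ΔB| ≤ c₁ := hΔBosc.trans h1.2.1.le
      -- `mixedP ≤ ΔI · M₁`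
      have hmix : mixedP κ ρ |ΔB| ΔI hh ≤ ΔI * M₁ κ ρ c₁ θ := by
        have hρ := abs_nonneg ρ
        have t1 : (hh : ℝ) * (|ρ| * ΔI) ≤ ΔI * |ρ| := by
          calc (hh : ℝ) * (|ρ| * ΔI) ≤ 1 * (|ρ| * ΔI) := by gcongr
            _ = ΔI * |ρ| := by ring
        have t2 : 4 * (|ρ| ^ 3 * ΔI ^ 3) ≤ ΔI * (4 * |ρ| ^ 3 * θ ^ 2) := by
          have : ΔI ^ 3 ≤ ΔI * θ ^ 2 := by
            calc ΔI ^ 3 = ΔI * (ΔI * ΔI) := by ring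
              _ ≤ ΔI * (θ * θ) := by gcongr
              _ = ΔI * θ ^ 2 := by ring
          calc 4 * (|ρ| ^ 3 * ΔI ^ 3) ≤ 4 * (|ρ| ^ 3 * (ΔI * θ ^ 2)) := by gcongr
            _ = _ := by ring
        have t3 : 4 * ΔI ^ 2 ≤ ΔI * (4 * θ) := by
          calc 4 * ΔI ^ 2 = 4 * (ΔI * ΔI) := by ring
            _ ≤ 4 * (ΔI * θ) := by gcongr
            _ = _ := by ring
        have t4 : 2 * ΔI * (Real.sqrt κ * |ΔB| + |ρ| * ΔI) ≤ ΔI * (2 * (Real.sqrt κ * c₁ + |ρ| * θ)) := by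
          have : Real.sqrt κ * |ΔB| + |ρ| * ΔI ≤ Real.sqrt κ * c₁ + |ρ| * θ := by gcongr
          calc 2 * ΔI * (Real.sqrt κ * |ΔB| + |ρ| * ΔI) ≤ 2 * ΔI * (Real.sqrt κ * c₁ + |ρ| * θ) := by gcongr
            _ = _ := by ring
        have t5 : 2 * (hh : ℝ) * ΔI ≤ ΔI * 2 := by
          calc 2 * (hh : ℝ) * ΔI ≤ 2 * 1 * ΔI := by gcongr
            _ = _ := by ring
        calc mixedP κ ρ |ΔB| ΔI hh = (hh : ℝ) * (|ρ| * ΔI) + 4 * (|ρ| ^ 3 * ΔI ^ 3) + 4 * ΔI ^ 2 +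
              2 * ΔI * (Real.sqrt κ * |ΔB| + |ρ| * ΔI) + 2 * (hh : ℝ) * ΔI + (hh : ℝ) * (|ρ| * ΔI) := rfl
          _ ≤ ΔI * |ρ| + ΔI * (4 * |ρ| ^ 3 * θ ^ 2) + ΔI * (4 * θ) + ΔI * (2 * (Real.sqrt κ * c₁ + |ρ| * θ)) + ΔI * 2 + ΔI * |ρ| :=
              add_le_add (add_le_add (add_le_add (add_le_add (add_le_add t1 t2) t3) t4) t5) t1
          _ = ΔI * M₁ κ ρ c₁ θ := by unfold M₁; ring
      have hdr : |(hh : ℝ) - (W u ω + 2 * I u ω) * ΔI| ≤ hh + K * ΔI := by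
        refine (abs_sub _ _).trans (add_le_add (le_of_eq (abs_of_nonneg hh0)) ?_)
        rw [abs_mul, abs_of_nonneg hΔI0]
        exact mul_le_mul_of_nonneg_right hZK hΔI0
      have hcr : 2 * Real.sqrt κ * |ρ| * |ΔB| * ΔI + ρ ^ 2 * ΔI ^ 2 ≤ ΔI * (2 * Real.sqrt κ * |ρ| * c₁ + ρ ^ 2 * θ) := by
        have s1 : 2 * Real.sqrt κ * |ρ| * |ΔB| * ΔI ≤ 2 * Real.sqrt κ * |ρ| * c₁ * ΔI := by gcongr
        have s2 : ρ ^ 2 * ΔI ^ 2 ≤ ρ ^ 2 * (ΔI * θ) := by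
          rw [pow_two ΔI]; exact mul_le_mul_of_nonneg_left (mul_le_mul_of_nonneg_left hΔIθ hΔI0) (sq_nonneg ρ)
        calc _ ≤ 2 * Real.sqrt κ * |ρ| * c₁ * ΔI + ρ ^ 2 * (ΔI * θ) := add_le_add s1 s2
          _ = _ := by ring
      have e : 1 * ΔI * Mtot κ ρ K c₁ θ + CH κ K * hh =
          K * (ΔI * M₁ κ ρ c₁ θ) + CH κ K * (hh + K * ΔI) + 2⁻¹ * (K + K ^ 2) * (ΔI * (2 * Real.sqrt κ * |ρ| * c₁ + ρ ^ 2 * θ)) := by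
        unfold Mtot; ring
      rw [e]
      have hk2 : 0 ≤ 2⁻¹ * (K + K ^ 2) := by positivity
      have i1 := mul_le_mul_of_nonneg_left hmix hK
      have i2 := mul_le_mul_of_nonneg_left hdr hCH
      have i3 := mul_le_mul_of_nonneg_left hcr hk2
      have eCH : (K + κ / 2 * (K + K ^ 2)) = CH κ K := rfl
      rw [eCH]
      exact add_le_add (add_le_add i1 i2) i3
    · exact absurd h1.2.2.2 h2
    · positivity
    · positivity
  calc Pcell κ ρ K τ I W c₁ θ u hh ω = _ := rfl
    _ ≤ _ := add_le_add (add_le_add hA hB) hC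
    _ = _ := by ring

/-! #### The small-cell bound on one cell -/

include h𝒮 in
/-- **Bound of the pathwise part of one `δ`-small cell**: if on `[u, u + hh]` the Brownian
oscillation, the clock increment and the oscillation of `Z` are `≤ δ ≤ min(1, θ)` and `hh ≤ δ²`,
then `Pcell ≤ 𝟙[u < τ < u + hh] bdryC δ + 𝟙[u + hh ≤ τ] ΔI δ M_lin` (the drift through
`abs_sub_mul_integral_le` and the Lebesgue-null zero set of `Z`). [folklore] -/
theorem Pcell_le_small {c₁ θ δ : ℝ} (hδ : 0 < δ) (hδ1 : δ ≤ 1) (hδθ : δ ≤ θ) {u hh : ℝ≥0} (hhδ : (hh : ℝ) ≤ δ ^ 2)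
    {ω : ℝ≥0 → ℝ} (hJ : ∀ T : ℝ≥0, IntervalIntegrable (fun r : ℝ ↦ J r.toNNReal ω) volume 0 T)
    (hIZ : ∀ t : ℝ≥0, ((t : ℝ≥0) : WithTop ℝ≥0) ≤ τ ω →
      I t ω = timeIntegral J t ω ∧ ((W t ω + 2 * I t ω) * J t ω = if W t ω + 2 * I t ω = 0 then 0 else 1))
    (hzero : volume {r : ℝ | 0 < r ∧ ((r.toNNReal : ℝ≥0) : WithTop ℝ≥0) ≤ τ ω ∧ W r.toNNReal ω + 2 * I r.toNNReal ω = 0} = 0)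
    (hosc : incRunSup u hh ω ≤ δ) (hΔI : I (u + hh) ω - I u ω ≤ δ)
    (hZ : ∀ r : ℝ≥0, u ≤ r → r ≤ u + hh → |(W r ω + 2 * I r ω) - (W u ω + 2 * I u ω)| ≤ δ) :
    Pcell κ ρ K τ I W c₁ θ u hh ω ≤
      (if ((u : ℝ≥0) : WithTop ℝ≥0) < τ ω ∧ τ ω < ((u + hh : ℝ≥0) : WithTop ℝ≥0) then bdryC κ ρ K * δ else 0) +
      (if ((u + hh : ℝ≥0) : WithTop ℝ≥0) ≤ τ ω then 1 * (I (u + hh) ω - I u ω) * (δ * Mlin κ ρ K) else 0) := by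
  have hκ := h𝒮.κ_pos.le
  have hK := h𝒮.K_pos.le
  set osc := incRunSup u hh ω with hosc'
  set ΔB := brownian (u + hh) ω - brownian u ω with hΔB
  set ΔI := I (u + hh) ω - I u ω with hΔI'
  have hΔI0 : 0 ≤ ΔI := sub_nonneg.2 (h𝒮.monotone_I ω le_self_add)
  have hh0 : (0 : ℝ) ≤ hh := hh.coe_nonneg
  have hosc0 : 0 ≤ osc := incRunSup_nonneg u hh ω
  have hΔBosc : |ΔB| ≤ osc := abs_incr_le_incRunSup le_rfl ω
  have hΔBδ : |ΔB| ≤ δ := hΔBosc.trans hosc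
  have hδ2 : δ ^ 2 ≤ δ := by nlinarith
  have hhδ' : (hh : ℝ) ≤ δ := hhδ.trans hδ2
  have hCH : 0 ≤ CH κ K := by unfold CH; positivity
  have hMlin : 0 ≤ Mlin κ ρ K := by unfold Mlin CH; positivity
  have hbC : 0 ≤ bdryC κ ρ K * δ := by
    have := bdryTerm_le_linear (ρ := ρ) hκ hK hδ.le hδ1
    have := bdryTerm_nonneg (ρ := ρ) hκ hK hδ.le hδ.le (sq_nonneg δ)
    linarith
  unfold Pcell
  have hT1 : (if ((u : ℝ≥0) : WithTop ℝ≥0) < τ ω ∧ osc < c₁ ∧ θ < ΔI then 1 + martBound κ K c₁ hh else 0) = 0 := by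
    rw [if_neg]; rintro ⟨-, -, h⟩; linarith
  rw [hT1, zero_add]
  refine add_le_add ?_ ?_
  · split_ifs with h1 h2 h2
    · calc bdryTerm κ ρ K osc ΔI hh ≤ bdryTerm κ ρ K δ δ (δ ^ 2) := bdryTerm_mono hκ hK hosc0 hΔI0 hh0 hosc hΔI hhδ
        _ ≤ bdryC κ ρ K * δ := bdryTerm_le_linear hκ hK hδ.le hδ1
    · exact absurd ⟨h1.1, h1.2.2.2⟩ h2
    · exact hbC
    · exact le_rfl
  · split_ifs with h1 h2 h2
    · -- the interior cell: clock part, drift through the cell identity, cross terms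
      have hmix : mixedP κ ρ |ΔB| ΔI hh ≤ ΔI * (δ * (|ρ| + 4 * |ρ| ^ 3 + 4 + 2 * (Real.sqrt κ + |ρ|) + 2 + |ρ|)) := by
        have hρ := abs_nonneg ρ
        have hΔI1 : ΔI ≤ 1 := hΔI.trans hδ1
        have t1 : (hh : ℝ) * (|ρ| * ΔI) ≤ ΔI * (δ * |ρ|) := by
          calc (hh : ℝ) * (|ρ| * ΔI) ≤ δ * (|ρ| * ΔI) := by gcongr
            _ = ΔI * (δ * |ρ|) := by ring
        have t2 : 4 * (|ρ| ^ 3 * ΔI ^ 3) ≤ ΔI * (δ * (4 * |ρ| ^ 3)) := by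
          have : ΔI ^ 3 ≤ ΔI * δ := by
            calc ΔI ^ 3 = ΔI * (ΔI * ΔI) := by ring
              _ ≤ ΔI * (δ * 1) := by gcongr
              _ = ΔI * δ := by ring
          calc 4 * (|ρ| ^ 3 * ΔI ^ 3) ≤ 4 * (|ρ| ^ 3 * (ΔI * δ)) := by gcongr
            _ = _ := by ring
        have t3 : 4 * ΔI ^ 2 ≤ ΔI * (δ * 4) := by
          calc 4 * ΔI ^ 2 = 4 * (ΔI * ΔI) := by ring
            _ ≤ 4 * (ΔI * δ) := by gcongr
            _ = _ := by ring
        have t4 : 2 * ΔI * (Real.sqrt κ * |ΔB| + |ρ| * ΔI) ≤ ΔI * (δ * (2 * (Real.sqrt κ + |ρ|))) := by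
          have : Real.sqrt κ * |ΔB| + |ρ| * ΔI ≤ Real.sqrt κ * δ + |ρ| * δ := by gcongr
          calc 2 * ΔI * (Real.sqrt κ * |ΔB| + |ρ| * ΔI) ≤ 2 * ΔI * (Real.sqrt κ * δ + |ρ| * δ) := by gcongr
            _ = _ := by ring
        have t5 : 2 * (hh : ℝ) * ΔI ≤ ΔI * (δ * 2) := by
          calc 2 * (hh : ℝ) * ΔI ≤ 2 * δ * ΔI := by gcongr
            _ = _ := by ring
        calc mixedP κ ρ |ΔB| ΔI hh = (hh : ℝ) * (|ρ| * ΔI) + 4 * (|ρ| ^ 3 * ΔI ^ 3) + 4 * ΔI ^ 2 +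
              2 * ΔI * (Real.sqrt κ * |ΔB| + |ρ| * ΔI) + 2 * (hh : ℝ) * ΔI + (hh : ℝ) * (|ρ| * ΔI) := rfl
          _ ≤ ΔI * (δ * |ρ|) + ΔI * (δ * (4 * |ρ| ^ 3)) + ΔI * (δ * 4) + ΔI * (δ * (2 * (Real.sqrt κ + |ρ|))) +
              ΔI * (δ * 2) + ΔI * (δ * |ρ|) :=
              add_le_add (add_le_add (add_le_add (add_le_add (add_le_add t1 t2) t3) t4) t5) t1
          _ = _ := by ring
      have hcr : 2 * Real.sqrt κ * |ρ| * |ΔB| * ΔI + ρ ^ 2 * ΔI ^ 2 ≤ ΔI * (δ * (2 * Real.sqrt κ * |ρ| + ρ ^ 2)) := by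
        have s1 : 2 * Real.sqrt κ * |ρ| * |ΔB| * ΔI ≤ 2 * Real.sqrt κ * |ρ| * δ * ΔI := by gcongr
        have s2 : ρ ^ 2 * ΔI ^ 2 ≤ ρ ^ 2 * (ΔI * δ) := by
          rw [pow_two ΔI]; exact mul_le_mul_of_nonneg_left (mul_le_mul_of_nonneg_left hΔI hΔI0) (sq_nonneg ρ)
        calc _ ≤ 2 * Real.sqrt κ * |ρ| * δ * ΔI + ρ ^ 2 * (ΔI * δ) := add_le_add s1 s2
          _ = _ := by ring
      -- the drift: `|hh − Z(u) ΔI| ≤ δ ΔI` by the cell identity and the null zero set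
      have hdr : |(hh : ℝ) - (W u ω + 2 * I u ω) * ΔI| ≤ δ * ΔI := by
        set Zf : ℝ → ℝ := fun r ↦ W r.toNNReal ω + 2 * I r.toNNReal ω with hZf
        set Jf : ℝ → ℝ := fun r ↦ J r.toNNReal ω with hJf
        have hab : (u : ℝ) ≤ (u : ℝ) + hh := by linarith
        have hJab : IntervalIntegrable Jf volume u ((u : ℝ) + hh) := by
          refine (hJ (u + hh)).mono_set ?_
          rw [uIcc_of_le hab, uIcc_of_le (by positivity)]
          exact Icc_subset_Icc u.coe_nonneg (by push_cast; exact le_rfl)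
        -- times of the cell are `≤ τ`
        have hcellτ : ∀ r ∈ Icc (u : ℝ) ((u : ℝ) + hh), ((r.toNNReal : ℝ≥0) : WithTop ℝ≥0) ≤ τ ω := by
          intro r hr
          have h2 : r.toNNReal ≤ u + hh := by
            rw [← Real.toNNReal_coe (r := u + hh)]; exact Real.toNNReal_le_toNNReal (by push_cast; exact hr.2)
          exact le_trans (by exact_mod_cast h2) h1.2.2.2
        have hZJ : ∀ r ∈ Icc (u : ℝ) ((u : ℝ) + hh), Zf r * Jf r = if Zf r = 0 then 0 else 1 := fun r hr ↦
          (hIZ _ (hcellτ r hr)).2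
        have hZc : Continuous Zf :=
          ((h𝒮.continuous_W ω).comp continuous_real_toNNReal).add
            (continuous_const.mul ((h𝒮.continuous_I ω).comp continuous_real_toNNReal))
        have hZm : MeasurableSet {r | Zf r = 0} := (isClosed_singleton.preimage hZc).measurableSet
        have hM : ∀ r ∈ Icc (u : ℝ) ((u : ℝ) + hh), |Zf r - Zf u| ≤ δ := by
          intro r hr
          have hr0 : 0 ≤ r := u.coe_nonneg.trans hr.1
          have h1 : u ≤ r.toNNReal := by rw [← Real.toNNReal_coe (r := u)]; exact Real.toNNReal_le_toNNReal hr.1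
          have h2 : r.toNNReal ≤ u + hh := by
            rw [← Real.toNNReal_coe (r := u + hh)]; exact Real.toNNReal_le_toNNReal (by push_cast; exact hr.2)
          have := hZ r.toNNReal h1 h2
          simpa [hZf, Real.toNNReal_coe] using this
        have key := abs_sub_mul_integral_le hab hJab (fun r ↦ h𝒮.J_nonneg _ ω) hZJ hZm hM
        -- identify the pieces
        have huτ : ((u : ℝ≥0) : WithTop ℝ≥0) ≤ τ ω := le_trans (by exact_mod_cast le_self_add) h1.2.2.2
        have hI : ∫ r in (u : ℝ)..((u : ℝ) + hh), Jf r = ΔI := by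
          rw [hΔI', (hIZ (u + hh) h1.2.2.2).1, (hIZ u huτ).1, timeIntegral, timeIntegral]
          push_cast
          rw [intervalIntegral.integral_interval_sub_left (hJ (u + hh) |>.mono_set (by
              rw [uIcc_of_le (by positivity), uIcc_of_le (by positivity)]; push_cast; exact le_rfl)) (hJ u)]
        have hZu : Zf u = W u ω + 2 * I u ω := by simp [hZf, Real.toNNReal_coe]
        have hvol : volume.real ({r | Zf r = 0} ∩ Ioc (u : ℝ) ((u : ℝ) + hh)) = 0 := by
          have hsub : {r | Zf r = 0} ∩ Ioc (u : ℝ) ((u : ℝ) + hh) ⊆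
              {r : ℝ | 0 < r ∧ ((r.toNNReal : ℝ≥0) : WithTop ℝ≥0) ≤ τ ω ∧ W r.toNNReal ω + 2 * I r.toNNReal ω = 0} :=
            fun r hr ↦ ⟨u.coe_nonneg.trans_lt hr.2.1, hcellτ r ⟨hr.2.1.le, hr.2.2⟩, hr.1⟩
          rw [Measure.real, measure_mono_null hsub hzero, ENNReal.toReal_zero]
        rw [hI, hZu, hvol, add_zero, show (u : ℝ) + hh - u = hh by ring] at key
        exact key
      have e : 1 * ΔI * (δ * Mlin κ ρ K) = K * (ΔI * (δ * (|ρ| + 4 * |ρ| ^ 3 + 4 + 2 * (Real.sqrt κ + |ρ|) + 2 + |ρ|))) +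
          CH κ K * (δ * ΔI) + 2⁻¹ * (K + K ^ 2) * (ΔI * (δ * (2 * Real.sqrt κ * |ρ| + ρ ^ 2))) := by
        unfold Mlin; ring
      rw [e]
      have hk2 : 0 ≤ 2⁻¹ * (K + K ^ 2) := by positivity
      have i1 := mul_le_mul_of_nonneg_left hmix hK
      have i2 := mul_le_mul_of_nonneg_left hdr hCH
      have i3 := mul_le_mul_of_nonneg_left hcr hk2
      have eCH : (K + κ / 2 * (K + K ^ 2)) = CH κ K := rfl
      rw [eCH]
      exact add_le_add (add_le_add i1 i2) i3
    · exact absurd h1.2.2.2 h2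
    · positivity
    · exact le_rfl

/-! #### The sums -/

omit h𝒮 in
/-- The pathwise part summed over the uniform partition of `[s, t]` into `n` cells. [folklore] -/
def Psum (κ ρ K : ℝ) (τ : (ℝ≥0 → ℝ) → WithTop ℝ≥0) (I W : ℝ≥0 → (ℝ≥0 → ℝ) → ℝ) (c₁ θ : ℝ) (s t : ℝ≥0) (n : ℕ)
    (ω : ℝ≥0 → ℝ) : ℝ :=
  ∑ i ∈ Finset.range n, Pcell κ ρ K τ I W c₁ θ (grid s t n i) (mesh s t n) ω

omit h𝒮 in
/-- `Σ (if P i then c else 0) = c · #{i | P i}`. [folklore] -/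
theorem sum_ite_const_eq {ι : Type*} (S : Finset ι) (P : ι → Prop) [DecidablePred P] (c : ℝ) :
    ∑ i ∈ S, (if P i then c else 0) = c * (S.filter P).card := by
  rw [← Finset.sum_filter, Finset.sum_const, nsmul_eq_mul, mul_comm]

include h𝒮 in
/-- **The pathwise sums are uniformly bounded**: `Psum ≤ Pconst` whenever the mesh is `≤ 1`.
[folklore] -/
theorem Psum_le_const (hst : s ≤ t) {c₁ θ : ℝ} (hc₁ : 0 < c₁) (hθ : 0 < θ) {n : ℕ} (hn : n ≠ 0) (hmesh : (mesh s t n : ℝ) ≤ 1)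
    (ω : ℝ≥0 → ℝ) : Psum κ ρ K τ I W c₁ θ s t n ω ≤ Pconst κ ρ K c₁ θ ((t : ℝ) - s) := by
  classical
  have hκ := h𝒮.κ_pos.le
  have hK := h𝒮.K_pos.le
  have hτ := h𝒮.τ_eq ω
  set T := h𝒮.τr ω with hT
  have hmB1 : 0 ≤ 1 + martBound κ K c₁ 1 := by have := martBound_nonneg hκ hK hc₁.le zero_le_one; linarith
  have hbd1 : 0 ≤ bdryTerm κ ρ K c₁ θ 1 := bdryTerm_nonneg hκ hK hc₁.le hθ.le zero_le_one
  have hMtot : 0 ≤ Mtot κ ρ K c₁ θ := by unfold Mtot M₁ CH; positivity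
  have hCH : 0 ≤ CH κ K := by unfold CH; positivity
  -- cellwise uniform bound, in grid form
  have hcell : ∀ i ∈ Finset.range n, Pcell κ ρ K τ I W c₁ θ (grid s t n i) (mesh s t n) ω ≤
      (if grid s t n i < T ∧ θ < I (grid s t n (i + 1)) ω - I (grid s t n i) ω then 1 + martBound κ K c₁ 1 else 0) +
      (if grid s t n i < T ∧ T < grid s t n (i + 1) then bdryTerm κ ρ K c₁ θ 1 else 0) +
      (if ((grid s t n (i + 1) : ℝ≥0) : WithTop ℝ≥0) ≤ τ ω then 1 * (I (grid s t n (i + 1)) ω - I (grid s t n i) ω) * Mtot κ ρ K c₁ θ else 0) +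
      CH κ K * mesh s t n := by
    intro i _
    have h := h𝒮.Pcell_le_unif hc₁ hθ (u := grid s t n i) (hh := mesh s t n) hmesh ω
    rw [← grid_succ'] at h
    have e1 : (((grid s t n i : ℝ≥0) : WithTop ℝ≥0) < τ ω) ↔ grid s t n i < T := by rw [hτ]; exact WithTop.coe_lt_coe
    have e2 : (τ ω < ((grid s t n (i + 1) : ℝ≥0) : WithTop ℝ≥0)) ↔ T < grid s t n (i + 1) := by rw [hτ]; exact WithTop.coe_lt_coe
    simp only [e1, e2] at h
    exact h
  refine (Finset.sum_le_sum hcell).trans ?_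
  rw [Finset.sum_add_distrib, Finset.sum_add_distrib, Finset.sum_add_distrib]
  -- (A) the cells of large clock increment
  have hA : ∑ i ∈ Finset.range n,
      (if grid s t n i < T ∧ θ < I (grid s t n (i + 1)) ω - I (grid s t n i) ω then 1 + martBound κ K c₁ 1 else 0) ≤
      (K / θ + 1) * (1 + martBound κ K c₁ 1) := by
    rw [sum_ite_const_eq, mul_comm]
    refine mul_le_mul_of_nonneg_right ?_ hmB1
    by_cases hsT : s ≤ T
    · have hKT : I T ω - I s ω ≤ K := by
        have := h𝒮.I_le_of_le (t := T) (ω := ω) (by rw [hτ])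
        linarith [h𝒮.I_nonneg s ω]
      exact card_filter_lt_and_lt_sub_le (h𝒮.monotone_I ω) hsT hθ hKT n
    · have hempty : (Finset.range n).filter (fun i ↦ grid s t n i < T ∧ θ < I (grid s t n (i + 1)) ω - I (grid s t n i) ω) = ∅ := by
        refine Finset.filter_false_of_mem fun i _ h ↦ hsT ?_
        exact (le_grid s t n i).trans h.1.le
      rw [hempty, Finset.card_empty, Nat.cast_zero]
      have := h𝒮.K_pos; positivity
  -- (B) the boundary cell
  have hB : ∑ i ∈ Finset.range n, (if grid s t n i < T ∧ T < grid s t n (i + 1) then bdryTerm κ ρ K c₁ θ 1 else 0) ≤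
      bdryTerm κ ρ K c₁ θ 1 := sum_ite_straddle_le s t T n hbd1
  -- (C) the interior cells
  have hC : ∑ i ∈ Finset.range n,
      (if ((grid s t n (i + 1) : ℝ≥0) : WithTop ℝ≥0) ≤ τ ω then 1 * (I (grid s t n (i + 1)) ω - I (grid s t n i) ω) * Mtot κ ρ K c₁ θ else 0) ≤
      Mtot κ ρ K c₁ θ * K := by
    have e : ∀ i, (if ((grid s t n (i + 1) : ℝ≥0) : WithTop ℝ≥0) ≤ τ ω then 1 * (I (grid s t n (i + 1)) ω - I (grid s t n i) ω) * Mtot κ ρ K c₁ θ else 0) =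
        Mtot κ ρ K c₁ θ * (if ((grid s t n (i + 1) : ℝ≥0) : WithTop ℝ≥0) ≤ τ ω then 1 * (I (grid s t n (i + 1)) ω - I (grid s t n i) ω) else 0) := by
      intro i; split_ifs <;> ring
    simp_rw [e]
    rw [← Finset.mul_sum]
    exact mul_le_mul_of_nonneg_left (h𝒮.sum_ite_mul_sub_le n ω (w := fun _ ↦ 1) (fun _ ↦ le_rfl)) hMtot
  -- (D) the `C_H h` terms
  have hD : ∑ i ∈ Finset.range n, CH κ K * (mesh s t n : ℝ) = CH κ K * ((t : ℝ) - s) := by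
    rw [Finset.sum_const, Finset.card_range, nsmul_eq_mul, ← natCast_mul_coe_mesh hst hn]; ring
  rw [hD, Pconst]
  linarith

include h𝒮 in
/-- **The pathwise sums tend to zero almost surely** (on every sample with locally integrable `J`
and Lebesgue-null zero set of `Z`): the oscillations of `B, I, Z` over the cells and the mesh are
eventually smaller than any `δ`, and then `Psum ≤ δ (bdryC + M_lin K)`.
[cite: LawlerSchrammWerner2003Restriction, proof of Lemma 8.9] -/
theorem tendsto_Psum (hst : s ≤ t) {c₁ θ : ℝ} (hc₁ : 0 < c₁) (hθ : 0 < θ) {ω : ℝ≥0 → ℝ}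
    (hJ : ∀ T : ℝ≥0, IntervalIntegrable (fun r : ℝ ↦ J r.toNNReal ω) volume 0 T)
    (hIZ : ∀ t : ℝ≥0, ((t : ℝ≥0) : WithTop ℝ≥0) ≤ τ ω →
      I t ω = timeIntegral J t ω ∧ ((W t ω + 2 * I t ω) * J t ω = if W t ω + 2 * I t ω = 0 then 0 else 1))
    (hzero : volume {r : ℝ | 0 < r ∧ ((r.toNNReal : ℝ≥0) : WithTop ℝ≥0) ≤ τ ω ∧ W r.toNNReal ω + 2 * I r.toNNReal ω = 0} = 0) :
    Tendsto (fun n ↦ Psum κ ρ K τ I W c₁ θ s t n ω) atTop (𝓝 0) := by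
  classical
  have hκ := h𝒮.κ_pos.le
  have hK := h𝒮.K_pos.le
  have hτ := h𝒮.τ_eq ω
  set T := h𝒮.τr ω with hT
  have hMlin : 0 ≤ Mlin κ ρ K := by unfold Mlin CH; positivity
  have hbC : 0 ≤ bdryC κ ρ K := by
    have h1 := bdryTerm_le_linear (ρ := ρ) hκ hK zero_le_one le_rfl
    have h2 := bdryTerm_nonneg (ρ := ρ) hκ hK zero_le_one zero_le_one (sq_nonneg (1 : ℝ))
    linarith
  set C := bdryC κ ρ K + Mlin κ ρ K * K with hC
  have hC0 : 0 ≤ C := by positivity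
  have hnonneg : ∀ n, 0 ≤ Psum κ ρ K τ I W c₁ θ s t n ω := fun n ↦
    Finset.sum_nonneg fun i _ ↦ h𝒮.Pcell_nonneg c₁ θ hc₁ _ _ ω
  -- the continuous paths
  have hcB : Continuous fun r ↦ brownian r ω := continuous_brownian ω
  have hcI : Continuous fun r ↦ I r ω := h𝒮.continuous_I ω
  have hcZ : Continuous fun r ↦ W r ω + 2 * I r ω := (h𝒮.continuous_W ω).add (continuous_const.mul hcI)
  rw [Metric.tendsto_atTop]
  intro ε hε
  -- the smallness parameter
  set δ := min 1 (min θ (ε / 2 / (C + 1))) with hδ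
  have hδ0 : 0 < δ := lt_min one_pos (lt_min hθ (by positivity))
  have hδ1 : δ ≤ 1 := min_le_left _ _
  have hδθ : δ ≤ θ := (min_le_right _ _).trans (min_le_left _ _)
  have hδε : δ * C ≤ ε / 2 := by
    have h1 : δ ≤ ε / 2 / (C + 1) := (min_le_right _ _).trans (min_le_right _ _)
    calc δ * C ≤ ε / 2 / (C + 1) * C := mul_le_mul_of_nonneg_right h1 hC0
      _ ≤ ε / 2 / (C + 1) * (C + 1) := by gcongr; linarith
      _ = ε / 2 := by field_simp
  have hev := ((eventually_forall_abs_sub_le hcB hst hδ0).and ((eventually_forall_abs_sub_le hcI hst hδ0).and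
    ((eventually_forall_abs_sub_le hcZ hst hδ0).and ((tendsto_mesh hst).eventually (eventually_le_nhds (sq_pos_of_pos hδ0))))))
  obtain ⟨N₀, hN₀⟩ := hev.exists_forall_of_atTop
  refine ⟨N₀, fun n hN ↦ ?_⟩
  obtain ⟨hB, hI, hZ, hmesh⟩ := hN₀ n hN
  rw [Real.dist_eq, sub_zero, abs_of_nonneg (hnonneg n)]
  -- cellwise small bound
  have hcell : ∀ i ∈ Finset.range n, Pcell κ ρ K τ I W c₁ θ (grid s t n i) (mesh s t n) ω ≤
      (if grid s t n i < T ∧ T < grid s t n (i + 1) then bdryC κ ρ K * δ else 0) +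
      (if ((grid s t n (i + 1) : ℝ≥0) : WithTop ℝ≥0) ≤ τ ω then 1 * (I (grid s t n (i + 1)) ω - I (grid s t n i) ω) * (δ * Mlin κ ρ K) else 0) := by
    intro i hi
    rw [Finset.mem_range] at hi
    have hosc : incRunSup (grid s t n i) (mesh s t n) ω ≤ δ := by
      refine incRunSup_le_of_forall fun v hv ↦ hB i hi (grid s t n i + v) le_self_add ?_
      rw [grid_succ']; exact add_le_add le_rfl hv
    have hΔI : I (grid s t n i + mesh s t n) ω - I (grid s t n i) ω ≤ δ := by
      have := hI i hi (grid s t n i + mesh s t n) le_self_add (by rw [grid_succ'])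
      exact (le_abs_self _).trans this
    have hZ' : ∀ r : ℝ≥0, grid s t n i ≤ r → r ≤ grid s t n i + mesh s t n →
        |(W r ω + 2 * I r ω) - (W (grid s t n i) ω + 2 * I (grid s t n i) ω)| ≤ δ := fun r hr1 hr2 ↦
      hZ i hi r hr1 (by rw [grid_succ']; exact hr2)
    have h := h𝒮.Pcell_le_small (c₁ := c₁) hδ0 hδ1 hδθ hmesh hJ hIZ hzero hosc hΔI hZ'
    rw [← grid_succ'] at h
    have e1 : (((grid s t n i : ℝ≥0) : WithTop ℝ≥0) < τ ω) ↔ grid s t n i < T := by rw [hτ]; exact WithTop.coe_lt_coe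
    have e2 : (τ ω < ((grid s t n (i + 1) : ℝ≥0) : WithTop ℝ≥0)) ↔ T < grid s t n (i + 1) := by rw [hτ]; exact WithTop.coe_lt_coe
    simp only [e1, e2] at h
    exact h
  have hsum := Finset.sum_le_sum hcell
  rw [Finset.sum_add_distrib] at hsum
  have hB' : ∑ i ∈ Finset.range n, (if grid s t n i < T ∧ T < grid s t n (i + 1) then bdryC κ ρ K * δ else 0) ≤ bdryC κ ρ K * δ :=
    sum_ite_straddle_le s t T n (by positivity)
  have hC' : ∑ i ∈ Finset.range n,
      (if ((grid s t n (i + 1) : ℝ≥0) : WithTop ℝ≥0) ≤ τ ω then 1 * (I (grid s t n (i + 1)) ω - I (grid s t n i) ω) * (δ * Mlin κ ρ K) else 0) ≤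
      δ * Mlin κ ρ K * K := by
    have e : ∀ i, (if ((grid s t n (i + 1) : ℝ≥0) : WithTop ℝ≥0) ≤ τ ω then 1 * (I (grid s t n (i + 1)) ω - I (grid s t n i) ω) * (δ * Mlin κ ρ K) else 0) =
        (δ * Mlin κ ρ K) * (if ((grid s t n (i + 1) : ℝ≥0) : WithTop ℝ≥0) ≤ τ ω then 1 * (I (grid s t n (i + 1)) ω - I (grid s t n i) ω) else 0) := by
      intro i; split_ifs <;> ring
    simp_rw [e]
    rw [← Finset.mul_sum]
    exact mul_le_mul_of_nonneg_left (h𝒮.sum_ite_mul_sub_le n ω (w := fun _ ↦ 1) (fun _ ↦ le_rfl)) (by positivity)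
  calc Psum κ ρ K τ I W c₁ θ s t n ω ≤ bdryC κ ρ K * δ + δ * Mlin κ ρ K * K := hsum.trans (add_le_add hB' hC')
    _ = δ * C := by rw [hC]; ring
    _ ≤ ε / 2 := hδε
    _ < ε := by linarith

end Sums

/-! ### Assembly: one cell in expectation -/

section Assembly

variable {s t : ℝ≥0}

omit h𝒮 in
/-- The real part of the martingale part. [folklore] -/
theorem re_martPart (κ : ℝ) (ℓ₁ ℓ₂ : ℂ) (ΔB h : ℝ) :
    (martPart κ ℓ₁ ℓ₂ ΔB h).re = Real.sqrt κ * ℓ₁.re * ΔB + κ / 2 * (ℓ₂ + ℓ₁ ^ 2).re * (ΔB ^ 2 - h) := by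
  unfold martPart
  simp only [Complex.add_re, Complex.mul_re, Complex.ofReal_re, Complex.ofReal_im, Complex.mul_im, zero_mul, mul_zero,
    sub_zero, add_zero]

include h𝒮 in
/-- A uniform constant bound of `Pcell` (for `h ≤ 1`), hence its integrability. [folklore] -/
theorem Pcell_le_bound {c₁ θ : ℝ} (hc₁ : 0 < c₁) (hθ : 0 < θ) {u hh : ℝ≥0} (hh1 : (hh : ℝ) ≤ 1) (ω : ℝ≥0 → ℝ) :
    Pcell κ ρ K τ I W c₁ θ u hh ω ≤ (1 + martBound κ K c₁ 1) + bdryTerm κ ρ K c₁ θ 1 + K * Mtot κ ρ K c₁ θ + CH κ K := by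
  have hκ := h𝒮.κ_pos.le
  have hK := h𝒮.K_pos.le
  have h := h𝒮.Pcell_le_unif hc₁ hθ (u := u) (hh := hh) hh1 ω
  have hmB1 : 0 ≤ 1 + martBound κ K c₁ 1 := by have := martBound_nonneg hκ hK hc₁.le zero_le_one; linarith
  have hbd1 : 0 ≤ bdryTerm κ ρ K c₁ θ 1 := bdryTerm_nonneg hκ hK hc₁.le hθ.le zero_le_one
  have hMtot : 0 ≤ Mtot κ ρ K c₁ θ := by unfold Mtot M₁ CH; positivity
  have hCH : 0 ≤ CH κ K := by unfold CH; positivity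
  have t1 : (if ((u : ℝ≥0) : WithTop ℝ≥0) < τ ω ∧ θ < I (u + hh) ω - I u ω then 1 + martBound κ K c₁ 1 else 0) ≤ 1 + martBound κ K c₁ 1 := by
    split_ifs <;> linarith
  have t2 : (if ((u : ℝ≥0) : WithTop ℝ≥0) < τ ω ∧ τ ω < ((u + hh : ℝ≥0) : WithTop ℝ≥0) then bdryTerm κ ρ K c₁ θ 1 else 0) ≤ bdryTerm κ ρ K c₁ θ 1 := by
    split_ifs <;> linarith
  have t3 : (if ((u + hh : ℝ≥0) : WithTop ℝ≥0) ≤ τ ω then 1 * (I (u + hh) ω - I u ω) * Mtot κ ρ K c₁ θ else 0) ≤ K * Mtot κ ρ K c₁ θ := by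
    split_ifs with hle
    · have hI1 : I (u + hh) ω ≤ K := h𝒮.I_le_of_le hle
      have hI0 := h𝒮.I_nonneg u ω
      rw [one_mul]
      exact mul_le_mul_of_nonneg_right (by linarith) hMtot
    · positivity
  have t4 : CH κ K * (hh : ℝ) ≤ CH κ K := by
    calc CH κ K * (hh : ℝ) ≤ CH κ K * 1 := by gcongr
      _ = _ := mul_one _
  linarith

include h𝒮 in
/-- `Pcell` is integrable (measurable and bounded). [folklore] -/
theorem integrable_Pcell {c₁ θ : ℝ} (hc₁ : 0 < c₁) (hθ : 0 < θ) {u hh : ℝ≥0} (hh1 : (hh : ℝ) ≤ 1) :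
    Integrable (Pcell κ ρ K τ I W c₁ θ u hh) preWienerMeasure := by
  haveI := isProbabilityMeasure_preWienerMeasure'
  refine (integrable_const ((1 + martBound κ K c₁ 1) + bdryTerm κ ρ K c₁ θ 1 + K * Mtot κ ρ K c₁ θ + CH κ K)).mono'
    (h𝒮.measurable_Pcell c₁ θ u hh).aestronglyMeasurable (ae_of_all _ fun ω ↦ ?_)
  rw [Real.norm_eq_abs, abs_of_nonneg (h𝒮.Pcell_nonneg c₁ θ hc₁ u hh ω)]
  exact h𝒮.Pcell_le_bound hc₁ hθ hh1 ω

include h𝒮 in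
/-- The stopped process is bounded by `1` in absolute value, measurable, integrable. [folklore] -/
theorem stopped_basic (r : ℝ≥0) :
    (∀ ω, stoppedProcess Y τ r ω ∈ Icc (0 : ℝ) 1) ∧ Measurable (stoppedProcess Y τ r) ∧
      Integrable (stoppedProcess Y τ r) preWienerMeasure := by
  haveI := isProbabilityMeasure_preWienerMeasure'
  have h1 : ∀ ω, stoppedProcess Y τ r ω ∈ Icc (0 : ℝ) 1 := fun ω ↦ h𝒮.Y_mem _ ω
  have h2 : Measurable (stoppedProcess Y τ r) := (h𝒮.adapted_stoppedProcess r).mono (brownianFiltration.le r) le_rfl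
  refine ⟨h1, h2, (integrable_const (1 : ℝ)).mono' h2.aestronglyMeasurable (ae_of_all _ fun ω ↦ ?_)⟩
  rw [Real.norm_eq_abs, abs_of_nonneg (h1 ω).1]; exact (h1 ω).2

include h𝒮 in
/-- **The cell estimate in expectation.** For `s ≤ u`, `S ∈ 𝓕_s`, a cell `[u, u + hh]` of length
`hh ≤ min(c₀, c₁²/8, 1)` and admissible thresholds: the set integral of the stopped increment is
bounded by `E[Ecell + Pcell]` — the martingale part integrates to zero against the `𝓕_u`-measurable
bounded weight `𝟙_S 𝟙{u < τ} Y_u (jets)`.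
[cite: LawlerSchrammWerner2003Restriction, proof of Lemma 8.9] -/
theorem abs_setIntegral_cell_le {u hh : ℝ≥0} (hsu : s ≤ u) {S : Set (ℝ≥0 → ℝ)} (hS : MeasurableSet[brownianFiltration s] S)
    (hh0 : 0 < hh) (hhc : (hh : ℝ) ≤ c₀) (hh1 : (hh : ℝ) ≤ 1) {c₁ θ : ℝ} (hc₁ : 0 < c₁) (hθ : 0 < θ)
    (hcθ : Real.sqrt κ * c₁ + |ρ| * θ ≤ c₀) (hθc : θ ≤ c₀) (hh8 : (hh : ℝ) ≤ c₁ ^ 2 / 8) :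
    |∫ ω in S, (stoppedProcess Y τ (u + hh) ω - stoppedProcess Y τ u ω) ∂preWienerMeasure| ≤
      ∫ ω, (Ecell κ K c₁ u hh ω + Pcell κ ρ K τ I W c₁ θ u hh ω) ∂preWienerMeasure := by
  classical
  haveI := isProbabilityMeasure_preWienerMeasure'
  have hκ := h𝒮.κ_pos.le
  have hK := h𝒮.K_pos.le
  have hτ := h𝒮.isStoppingTime
  have hSm : MeasurableSet S := brownianFiltration.le s _ hS
  obtain ⟨hX1m, hX1meas, hX1i⟩ := h𝒮.stopped_basic (u + hh)
  obtain ⟨hX0m, hX0meas, hX0i⟩ := h𝒮.stopped_basic u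
  -- notation
  set Tset : Set (ℝ≥0 → ℝ) := {ω | ((u : ℝ≥0) : WithTop ℝ≥0) < τ ω} with hTset
  have hTm_u : MeasurableSet[brownianFiltration u] Tset := hτ.measurableSet_gt u
  have hTm : MeasurableSet Tset := brownianFiltration.le u _ hTm_u
  set g : (ℝ≥0 → ℝ) → ℝ := fun ω ↦ S.indicator (fun _ ↦ (1 : ℝ)) ω * Tset.indicator (fun _ ↦ (1 : ℝ)) ω with hg
  set D : (ℝ≥0 → ℝ) → ℝ := fun ω ↦ stoppedProcess Y τ (u + hh) ω - stoppedProcess Y τ u ω with hD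
  set ΔB : (ℝ≥0 → ℝ) → ℝ := fun ω ↦ brownian (u + hh) ω - brownian u ω with hΔB
  set ξ₁ : (ℝ≥0 → ℝ) → ℝ := fun ω ↦ g ω * Y u ω * (Real.sqrt κ * (ℓ₁ u ω).re) with hξ₁
  set ξ₂ : (ℝ≥0 → ℝ) → ℝ := fun ω ↦ g ω * Y u ω * (κ / 2 * (ℓ₂ u ω + ℓ₁ u ω ^ 2).re) with hξ₂
  set rest : (ℝ≥0 → ℝ) → ℝ := fun ω ↦ g ω * D ω - (ξ₁ ω * ΔB ω + ξ₂ ω * (ΔB ω ^ 2 - hh)) with hrest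
  -- `g ∈ {0, 1}`, `𝓕_u`-measurable, vanishing unless `u < τ`
  have hg01 : ∀ ω, g ω = 0 ∨ g ω = 1 := fun ω ↦ by
    simp only [hg, Set.indicator_apply]; split_ifs <;> simp
  have hg1 : ∀ ω, |g ω| ≤ 1 := fun ω ↦ by rcases hg01 ω with h | h <;> simp [h]
  have hgτ : ∀ ω, g ω ≠ 0 → ((u : ℝ≥0) : WithTop ℝ≥0) < τ ω := fun ω h ↦ by
    by_contra hnot
    exact h (by simp only [hg]; rw [Set.indicator_of_notMem (show ω ∉ Tset from hnot), mul_zero])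
  have hgm_u : Measurable[brownianFiltration u] g := by
    have h1 : Measurable[brownianFiltration u] (S.indicator fun _ ↦ (1 : ℝ)) :=
      (measurable_const (a := (1 : ℝ))).indicator (brownianFiltration.mono hsu _ hS)
    have h2 : Measurable[brownianFiltration u] (Tset.indicator fun _ ↦ (1 : ℝ)) :=
      (measurable_const (a := (1 : ℝ))).indicator hTm_u
    exact h1.mul h2
  have hgm : Measurable g := hgm_u.mono (brownianFiltration.le u) le_rfl
  -- measurability of the jets' real parts and of `ξ₁, ξ₂`
  have hYu : Measurable[brownianFiltration u] (Y u) := h𝒮.adapted_Y u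
  have hℓ₁ : Measurable[brownianFiltration u] (fun ω ↦ (ℓ₁ u ω).re) := Complex.measurable_re.comp (h𝒮.adapted_ℓ₁ u)
  have hℓ₂ : Measurable[brownianFiltration u] (fun ω ↦ (ℓ₂ u ω + ℓ₁ u ω ^ 2).re) :=
    Complex.measurable_re.comp ((h𝒮.adapted_ℓ₂ u).add ((h𝒮.adapted_ℓ₁ u).pow_const 2))
  have hξ₁m : StronglyMeasurable[brownianFiltration u] ξ₁ := ((hgm_u.mul hYu).mul (hℓ₁.const_mul _)).stronglyMeasurable
  have hξ₂m : StronglyMeasurable[brownianFiltration u] ξ₂ := ((hgm_u.mul hYu).mul (hℓ₂.const_mul _)).stronglyMeasurable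
  -- bounds on `ξ₁, ξ₂`
  have hY1 : ∀ ω, |Y u ω| ≤ 1 := fun ω ↦ abs_le.2 ⟨by linarith [(h𝒮.Y_mem u ω).1], (h𝒮.Y_mem u ω).2⟩
  have hξ₁b : ∀ ω, |ξ₁ ω| ≤ Real.sqrt κ * K := by
    intro ω
    by_cases h0 : g ω = 0
    · simp only [hξ₁, h0, zero_mul, abs_zero]; positivity
    · obtain ⟨h1, -, -, -, -, -⟩ := h𝒮.bound u ω (hgτ ω h0).le
      simp only [hξ₁, abs_mul, abs_of_nonneg (Real.sqrt_nonneg κ)]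
      have hre : |(ℓ₁ u ω).re| ≤ K := (Complex.abs_re_le_norm _).trans h1
      calc |g ω| * |Y u ω| * (Real.sqrt κ * |(ℓ₁ u ω).re|) ≤ 1 * 1 * (Real.sqrt κ * K) := by gcongr <;> first | exact hg1 ω | exact hY1 ω
        _ = _ := by ring
  have hξ₂b : ∀ ω, |ξ₂ ω| ≤ κ / 2 * (K + K ^ 2) := by
    intro ω
    by_cases h0 : g ω = 0
    · simp only [hξ₂, h0, zero_mul, abs_zero]; positivity
    · obtain ⟨h1, -, h2, -, -, -⟩ := h𝒮.bound u ω (hgτ ω h0).le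
      simp only [hξ₂, abs_mul, abs_of_nonneg (by positivity : (0 : ℝ) ≤ κ / 2)]
      have hre : |(ℓ₂ u ω + ℓ₁ u ω ^ 2).re| ≤ K + K ^ 2 :=
        (Complex.abs_re_le_norm _).trans ((norm_add_le _ _).trans (add_le_add h2 (by rw [norm_pow]; gcongr)))
      calc |g ω| * |Y u ω| * (κ / 2 * |(ℓ₂ u ω + ℓ₁ u ω ^ 2).re|) ≤ 1 * 1 * (κ / 2 * (K + K ^ 2)) := by
            gcongr <;> first | exact hg1 ω | exact hY1 ω
        _ = _ := by ring
  -- integrability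
  have hΔBi : Integrable ΔB preWienerMeasure := (memLp_two_brownian_sub u (u + hh)).integrable one_le_two
  have hsqi : Integrable (fun ω ↦ ΔB ω ^ 2 - (hh : ℝ)) preWienerMeasure := by
    have := integrable_sqIncr u (u + hh)
    refine this.congr (ae_of_all _ fun ω ↦ ?_)
    simp only [hΔB, Pi.sub_apply]; push_cast; ring
  have hgDi : Integrable (fun ω ↦ g ω * D ω) preWienerMeasure := by
    refine (integrable_const (1 : ℝ)).mono' (hgm.mul (hX1meas.sub hX0meas)).aestronglyMeasurable (ae_of_all _ fun ω ↦ ?_)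
    rw [Real.norm_eq_abs, abs_mul]
    have hD1 : |D ω| ≤ 1 := abs_le.2 ⟨by linarith [(hX1m ω).1, (hX0m ω).2], by linarith [(hX1m ω).2, (hX0m ω).1]⟩
    calc |g ω| * |D ω| ≤ 1 * 1 := mul_le_mul (hg1 ω) hD1 (abs_nonneg _) zero_le_one
      _ = 1 := one_mul 1
  have hξ₁mA : AEStronglyMeasurable ξ₁ preWienerMeasure := (hξ₁m.mono (brownianFiltration.le u)).aestronglyMeasurable
  have hξ₂mA : AEStronglyMeasurable ξ₂ preWienerMeasure := (hξ₂m.mono (brownianFiltration.le u)).aestronglyMeasurable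
  have hm1i : Integrable (fun ω ↦ ξ₁ ω * ΔB ω) preWienerMeasure :=
    hΔBi.bdd_mul hξ₁mA (ae_of_all _ fun ω ↦ by rw [Real.norm_eq_abs]; exact hξ₁b ω)
  have hm2i : Integrable (fun ω ↦ ξ₂ ω * (ΔB ω ^ 2 - hh)) preWienerMeasure :=
    hsqi.bdd_mul hξ₂mA (ae_of_all _ fun ω ↦ by rw [Real.norm_eq_abs]; exact hξ₂b ω)
  have hmi : Integrable (fun ω ↦ ξ₁ ω * ΔB ω + ξ₂ ω * (ΔB ω ^ 2 - hh)) preWienerMeasure := hm1i.add hm2i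
  have hresti : Integrable rest preWienerMeasure := hgDi.sub hmi
  -- (1) the set integral is `∫ g D`
  have hset : ∫ ω in S, D ω ∂preWienerMeasure = ∫ ω, g ω * D ω ∂preWienerMeasure := by
    rw [← integral_indicator hSm]
    refine integral_congr_ae (ae_of_all _ fun ω ↦ ?_)
    simp only [hg]
    by_cases hωS : ω ∈ S
    · rw [Set.indicator_of_mem hωS, Set.indicator_of_mem hωS, one_mul]
      by_cases hωT : ω ∈ Tset
      · rw [Set.indicator_of_mem hωT, one_mul]
      · rw [Set.indicator_of_notMem hωT, zero_mul]
        have hle : τ ω ≤ ((u : ℝ≥0) : WithTop ℝ≥0) := not_lt.1 hωT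
        have hle' : τ ω ≤ ((u + hh : ℝ≥0) : WithTop ℝ≥0) := hle.trans (by exact_mod_cast le_self_add)
        simp only [hD, stoppedProcess_eq_of_ge hle, stoppedProcess_eq_of_ge hle', sub_self]
    · rw [Set.indicator_of_notMem hωS, Set.indicator_of_notMem hωS, zero_mul, zero_mul]
  -- (2) the martingale part integrates to zero
  have hmart1 : ∫ ω, ξ₁ ω * ΔB ω ∂preWienerMeasure = 0 := by
    have := integral_mul_brownian_sub_eq_zero (a := u) (b := u + hh) le_self_add hξ₁m
    simpa [hΔB] using this
  have hmart2 : ∫ ω, ξ₂ ω * (ΔB ω ^ 2 - hh) ∂preWienerMeasure = 0 := by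
    have := integral_mul_sqIncr_eq_zero (s := u) (u := u + hh) le_self_add hξ₂m hξ₂b
    have e : ((u + hh : ℝ≥0) : ℝ) - u = hh := by push_cast; ring
    rw [e] at this
    exact this
  have hgD : ∫ ω, g ω * D ω ∂preWienerMeasure = ∫ ω, rest ω ∂preWienerMeasure := by
    have e : (fun ω ↦ g ω * D ω) = fun ω ↦ rest ω + (ξ₁ ω * ΔB ω + ξ₂ ω * (ΔB ω ^ 2 - hh)) := by
      funext ω; simp only [hrest]; ring
    rw [e, integral_add hresti hmi, integral_add hm1i hm2i, hmart1, hmart2]; ring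
  -- (3) the pointwise bound `|rest| ≤ Ecell + Pcell` a.e.
  have hbound : ∀ᵐ ω ∂preWienerMeasure, |rest ω| ≤ Ecell κ K c₁ u hh ω + Pcell κ ρ K τ I W c₁ θ u hh ω := by
    filter_upwards [h𝒮.ae_W, h𝒮.ae_identity, h𝒮.ae_one_step] with ω hω hidω hpathω
    have hre : rest ω = ((g ω : ℂ) * (((D ω : ℝ)) : ℂ) - g ω * Y u ω * martPart κ (ℓ₁ u ω) (ℓ₂ u ω) (ΔB ω) hh).re := by
      simp only [hrest, hξ₁, hξ₂, Complex.sub_re, Complex.mul_re, Complex.ofReal_re, Complex.ofReal_im, zero_mul, sub_zero,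
        mul_zero, re_martPart, Complex.mul_im, add_zero]
      ring
    rw [hre]
    refine (Complex.abs_re_le_norm _).trans ?_
    have h1 := h𝒮.norm_cell_sub_martPart_le hω hpathω hidω (u := u) hh0 hhc hc₁ hcθ hθc (hg01 ω) (hgτ ω)
    exact h1.trans (h𝒮.cellBound_le_Ecell_add_Pcell hω u hh)
  -- (4) integrate
  have hEi := (integral_Ecell_le hκ hK hc₁ u hh hh8).1
  have hPi := h𝒮.integrable_Pcell hc₁ hθ (u := u) (hh := hh) hh1
  rw [hset, hgD]
  calc |∫ ω, rest ω ∂preWienerMeasure| ≤ ∫ ω, |rest ω| ∂preWienerMeasure := abs_integral_le_integral_abs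
    _ ≤ _ := integral_mono_ae hresti.abs (hEi.add hPi) hbound

include h𝒮 in
/-- **Summing the cell estimates over a uniform partition of `[s, t]`** (mesh
`≤ min(c₀, 1, c₁²/8)`): `|∫_S (Y^τ_t − Y^τ_s)| ≤ (t − s) · erate(mesh) + E[Psum]`.
[cite: LawlerSchrammWerner2003Restriction, proof of Lemma 8.9] -/
theorem abs_setIntegral_sub_le (hst : s ≤ t) {S : Set (ℝ≥0 → ℝ)} (hS : MeasurableSet[brownianFiltration s] S)
    {c₁ θ : ℝ} (hc₁ : 0 < c₁) (hθ : 0 < θ) (hcθ : Real.sqrt κ * c₁ + |ρ| * θ ≤ c₀) (hθc : θ ≤ c₀) {n : ℕ} (hn : n ≠ 0)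
    (hpos : 0 < mesh s t n) (hmc : (mesh s t n : ℝ) ≤ c₀) (hm1 : (mesh s t n : ℝ) ≤ 1) (hm8 : (mesh s t n : ℝ) ≤ c₁ ^ 2 / 8) :
    |∫ ω in S, (stoppedProcess Y τ t ω - stoppedProcess Y τ s ω) ∂preWienerMeasure| ≤
      ((t : ℝ) - s) * erate κ K c₁ (mesh s t n) + ∫ ω, Psum κ ρ K τ I W c₁ θ s t n ω ∂preWienerMeasure := by
  haveI := isProbabilityMeasure_preWienerMeasure'
  have hκ := h𝒮.κ_pos.le
  have hK := h𝒮.K_pos.le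
  set X := stoppedProcess Y τ with hX
  set u : ℕ → ℝ≥0 := grid s t n with hu
  set h := mesh s t n with hh
  have hint : ∀ i, Integrable (X (u i)) preWienerMeasure := fun i ↦ (h𝒮.stopped_basic (u i)).2.2
  -- telescoping
  have htel : ∫ ω in S, (X t ω - X s ω) ∂preWienerMeasure =
      ∑ i ∈ Finset.range n, ∫ ω in S, (X (u (i + 1)) ω - X (u i) ω) ∂preWienerMeasure := by
    have e1 : (fun ω ↦ X t ω - X s ω) = fun ω ↦ ∑ i ∈ Finset.range n, (X (u (i + 1)) ω - X (u i) ω) := by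
      funext ω
      rw [Finset.sum_range_sub (fun i ↦ X (u i) ω), hu, grid_self hst hn, grid_zero]
    have hint' : ∀ i ∈ Finset.range n, Integrable (fun ω ↦ X (u (i + 1)) ω - X (u i) ω) (preWienerMeasure.restrict S) :=
      fun i _ ↦ ((hint (i + 1)).sub (hint i)).integrableOn
    rw [e1]
    exact integral_finsetSum (Finset.range n) (f := fun i ω ↦ X (u (i + 1)) ω - X (u i) ω) hint'
  rw [htel]
  -- the cell estimates
  have hcell : ∀ i ∈ Finset.range n, |∫ ω in S, (X (u (i + 1)) ω - X (u i) ω) ∂preWienerMeasure| ≤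
      ∫ ω, (Ecell κ K c₁ (u i) h ω + Pcell κ ρ K τ I W c₁ θ (u i) h ω) ∂preWienerMeasure := by
    intro i _
    have e : u (i + 1) = u i + h := grid_succ' s t n i
    rw [e]
    exact h𝒮.abs_setIntegral_cell_le (le_grid s t n i) hS hpos hmc hm1 hc₁ hθ hcθ hθc hm8
  have hEi : ∀ i, Integrable (Ecell κ K c₁ (u i) h) preWienerMeasure ∧
      ∫ ω, Ecell κ K c₁ (u i) h ω ∂preWienerMeasure ≤ (h : ℝ) * erate κ K c₁ h := fun i ↦
    integral_Ecell_le hκ hK hc₁ (u i) h hm8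
  have hPi : ∀ i, Integrable (Pcell κ ρ K τ I W c₁ θ (u i) h) preWienerMeasure := fun i ↦
    h𝒮.integrable_Pcell hc₁ hθ hm1
  calc |∑ i ∈ Finset.range n, ∫ ω in S, (X (u (i + 1)) ω - X (u i) ω) ∂preWienerMeasure|
      ≤ ∑ i ∈ Finset.range n, |∫ ω in S, (X (u (i + 1)) ω - X (u i) ω) ∂preWienerMeasure| := Finset.abs_sum_le_sum_abs _ _
    _ ≤ ∑ i ∈ Finset.range n, ∫ ω, (Ecell κ K c₁ (u i) h ω + Pcell κ ρ K τ I W c₁ θ (u i) h ω) ∂preWienerMeasure :=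
        Finset.sum_le_sum hcell
    _ = ∑ i ∈ Finset.range n, (∫ ω, Ecell κ K c₁ (u i) h ω ∂preWienerMeasure + ∫ ω, Pcell κ ρ K τ I W c₁ θ (u i) h ω ∂preWienerMeasure) :=
        Finset.sum_congr rfl fun i _ ↦ integral_add (hEi i).1 (hPi i)
    _ = ∑ i ∈ Finset.range n, ∫ ω, Ecell κ K c₁ (u i) h ω ∂preWienerMeasure +
          ∑ i ∈ Finset.range n, ∫ ω, Pcell κ ρ K τ I W c₁ θ (u i) h ω ∂preWienerMeasure := Finset.sum_add_distrib
    _ ≤ ∑ i ∈ Finset.range n, (h : ℝ) * erate κ K c₁ h + ∫ ω, Psum κ ρ K τ I W c₁ θ s t n ω ∂preWienerMeasure := by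
        refine add_le_add (Finset.sum_le_sum fun i _ ↦ (hEi i).2) (le_of_eq ?_)
        rw [← integral_finsetSum _ (fun i _ ↦ hPi i)]
        rfl
    _ = ((t : ℝ) - s) * erate κ K c₁ h + ∫ ω, Psum κ ρ K τ I W c₁ θ s t n ω ∂preWienerMeasure := by
        rw [Finset.sum_const, Finset.card_range, nsmul_eq_mul, ← natCast_mul_coe_mesh hst hn]; ring

include h𝒮 in
/-- **`∫_S (Y^τ_t − Y^τ_s) = 0` for `s ≤ t` and `S ∈ 𝓕_s`**: the bound of `abs_setIntegral_sub_le`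
tends to `0` along `n → ∞` (`erate(mesh) → 0`; `E[Psum] → 0` by dominated convergence, the sums
being uniformly bounded and almost surely convergent to `0`).
[cite: LawlerSchrammWerner2003Restriction, Lemma 8.9] -/
theorem setIntegral_stopped_sub_eq_zero (hst : s ≤ t) {S : Set (ℝ≥0 → ℝ)} (hS : MeasurableSet[brownianFiltration s] S) :
    ∫ ω in S, (stoppedProcess Y τ t ω - stoppedProcess Y τ s ω) ∂preWienerMeasure = 0 := by
  haveI := isProbabilityMeasure_preWienerMeasure'
  rcases hst.eq_or_lt with heq | hst'
  · subst heq; simp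
  have hκ := h𝒮.κ_pos.le
  have hK := h𝒮.K_pos.le
  have hc₀ := h𝒮.c₀_pos
  -- the thresholds
  set c₁ : ℝ := c₀ / (2 * (Real.sqrt κ + 1)) with hc₁def
  set θ : ℝ := c₀ / (2 * (|ρ| + 1)) with hθdef
  have hc₁ : 0 < c₁ := by positivity
  have hθ : 0 < θ := by positivity
  have hcθ : Real.sqrt κ * c₁ + |ρ| * θ ≤ c₀ := by
    have h1 : Real.sqrt κ * c₁ ≤ c₀ / 2 := by
      rw [hc₁def, mul_div_assoc', div_le_div_iff₀ (by positivity) (by positivity)]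
      nlinarith [Real.sqrt_nonneg κ, hc₀]
    have h2 : |ρ| * θ ≤ c₀ / 2 := by
      rw [hθdef, mul_div_assoc', div_le_div_iff₀ (by positivity) (by positivity)]
      nlinarith [abs_nonneg ρ, hc₀]
    linarith
  have hθc : θ ≤ c₀ := by
    rw [hθdef, div_le_iff₀ (by positivity)]; nlinarith [abs_nonneg ρ, hc₀]
  set Iv : ℝ := ∫ ω in S, (stoppedProcess Y τ t ω - stoppedProcess Y τ s ω) ∂preWienerMeasure with hIv
  -- the vanishing bound
  set a : ℕ → ℝ := fun n ↦ ((t : ℝ) - s) * erate κ K c₁ (mesh s t n) + ∫ ω, Psum κ ρ K τ I W c₁ θ s t n ω ∂preWienerMeasure with ha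
  have hmesh := tendsto_mesh hst
  have hmesh0 : Tendsto (fun n ↦ (mesh s t n : ℝ)) atTop (𝓝[≥] 0) :=
    tendsto_nhdsWithin_iff.2 ⟨hmesh, Eventually.of_forall fun n ↦ (mesh s t n).coe_nonneg⟩
  have h1 : Tendsto (fun n ↦ ((t : ℝ) - s) * erate κ K c₁ (mesh s t n)) atTop (𝓝 0) := by
    have := ((tendsto_erate κ K c₁).comp hmesh0).const_mul ((t : ℝ) - s)
    rwa [mul_zero] at this
  have h2 : Tendsto (fun n ↦ ∫ ω, Psum κ ρ K τ I W c₁ θ s t n ω ∂preWienerMeasure) atTop (𝓝 0) := by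
    have hmeas : ∀ n, AEStronglyMeasurable (Psum κ ρ K τ I W c₁ θ s t n) preWienerMeasure := fun n ↦
      (Finset.measurable_sum _ fun i _ ↦ h𝒮.measurable_Pcell c₁ θ _ _).aestronglyMeasurable
    have hbound : ∀ᶠ n in atTop, ∀ᵐ ω ∂preWienerMeasure, ‖Psum κ ρ K τ I W c₁ θ s t n ω‖ ≤ Pconst κ ρ K c₁ θ ((t : ℝ) - s) := by
      filter_upwards [hmesh.eventually (eventually_le_nhds one_pos), eventually_ne_atTop 0] with n hN hn
      exact ae_of_all _ fun ω ↦ by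
        have h0 : 0 ≤ Psum κ ρ K τ I W c₁ θ s t n ω := Finset.sum_nonneg fun i _ ↦ h𝒮.Pcell_nonneg c₁ θ hc₁ _ _ ω
        rw [Real.norm_eq_abs, abs_of_nonneg h0]
        exact h𝒮.Psum_le_const hst hc₁ hθ hn hN ω
    have hlim : ∀ᵐ ω ∂preWienerMeasure, Tendsto (fun n ↦ Psum κ ρ K τ I W c₁ θ s t n ω) atTop (𝓝 ((fun _ ↦ (0 : ℝ)) ω)) := by
      filter_upwards [h𝒮.ae_clock] with ω hω
      exact h𝒮.tendsto_Psum hst hc₁ hθ hω.1 hω.2.1 hω.2.2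
    have := tendsto_integral_filter_of_dominated_convergence (fun _ ↦ Pconst κ ρ K c₁ θ ((t : ℝ) - s))
      (Eventually.of_forall hmeas) hbound (integrable_const _) hlim
    simpa using this
  have hlimit : Tendsto a atTop (𝓝 0) := by
    have := h1.add h2; rwa [add_zero] at this
  -- eventually the bound applies
  have hev : ∀ᶠ n in atTop, |Iv| ≤ a n := by
    have hsmall : (0 : ℝ) < min c₀ (min 1 (c₁ ^ 2 / 8)) := lt_min hc₀ (lt_min one_pos (by positivity))
    filter_upwards [hmesh.eventually (eventually_le_nhds hsmall), eventually_ne_atTop 0] with n hN hn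
    have hmc : (mesh s t n : ℝ) ≤ c₀ := hN.trans (min_le_left _ _)
    have hm1 : (mesh s t n : ℝ) ≤ 1 := hN.trans ((min_le_right _ _).trans (min_le_left _ _))
    have hm8 : (mesh s t n : ℝ) ≤ c₁ ^ 2 / 8 := hN.trans ((min_le_right _ _).trans (min_le_right _ _))
    exact h𝒮.abs_setIntegral_sub_le hst hS hc₁ hθ hcθ hθc hn (mesh_pos hst' hn) hmc hm1 hm8
  have hI0 : |Iv| ≤ 0 := ge_of_tendsto hlimit hev
  exact abs_nonpos_iff.1 hI0

include h𝒮 in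
/-- **[LSW] Lemma 8.9 in the abstract cell scheme: the stopped process `Y^τ` is an
`𝓕`-martingale** (adapted: `adapted_stoppedProcess`; bounded; and `∫_S (Y^τ_t − Y^τ_s) = 0` for
every `S ∈ 𝓕_s`, `setIntegral_stopped_sub_eq_zero`).
[cite: LawlerSchrammWerner2003Restriction, Lemma 8.9] -/
theorem martingale_stoppedProcess : Martingale (stoppedProcess Y τ) brownianFiltration preWienerMeasure := by
  haveI := isProbabilityMeasure_preWienerMeasure'
  have hSA : StronglyAdapted brownianFiltration (stoppedProcess Y τ) := fun r ↦ (h𝒮.adapted_stoppedProcess r).stronglyMeasurable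
  refine ⟨hSA, fun i j hij ↦ ?_⟩
  have hm : brownianFiltration i ≤ (inferInstance : MeasurableSpace (ℝ≥0 → ℝ)) := brownianFiltration.le i
  haveI : IsFiniteMeasure (preWienerMeasure.trim hm) := isFiniteMeasure_trim hm
  have hint : ∀ r, Integrable (stoppedProcess Y τ r) preWienerMeasure := fun r ↦ (h𝒮.stopped_basic r).2.2
  refine (ae_eq_condExp_of_forall_setIntegral_eq hm (hint j) (fun S _ _ ↦ (hint i).integrableOn) (fun S hS _ ↦ ?_)
    ((hSA i).aestronglyMeasurable)).symm
  have h0 := h𝒮.setIntegral_stopped_sub_eq_zero hij hS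
  rw [integral_sub (hint j).integrableOn (hint i).integrableOn, sub_eq_zero] at h0
  exact h0.symm

end Assembly

end CellScheme

end SLEKappaRho

end Literature.Probability.RandomPlanarGeometry

end
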